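import Literature.NumberTheory.Sieve.BombieriAsymptoticSieveGeneralHyp
import Literature.NumberTheory.Sieve.BombieriAsymptoticSieveOscillation
import Literature.NumberTheory.Sieve.BombieriAsymptoticSieveSigma0SmoothParts
import HarnessLib

/-!
# Bombieri's asymptotic sieve under the hypotheses of `Literature.NumberTheory.Sieve.bombieri_asymptotic_sieve`: the `Σ₀`-estimate

Topic `Literature/NumberTheory/Sieve`, companion file of `BombieriAsymptoticSieve.lean`,
`BombieriAsymptoticSieveSigma0SmoothParts.lean` and `ParityBarrier.lean`. Everything here is PROVED
(theorems only, no new definitions, no `sorry`).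

[FriedlanderIwaniecPisa1978] Lemma 10 (= Bombieri's Lemmata 1, 2) bounds the contribution
`Σ₀ = ∑_{n ≤ x, (n, P(z)) > 1} Λ_k(n) a_n` of the non-rough `n` by
`≪ A(x)(log x)^{k−2} log z + o(A(x)(log x)^{k−1})`. The tree proves it twice under Bombieri's
axioms (A₁)–(A₅) (`FI1978_lemma10_holds`, `BombieriSieve.FI1978_lemma10_small`); both proofs use
(A₂) for PRIME-POWER moduli. Here it is proved, in the small range `2 ≤ z ≤ x^{θ₀}`,
`θ₀ = 1/(2(k+10))`, which is all the assembly of the theorem needs, under the hypotheses of the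
tree's `Literature.NumberTheory.Sieve.bombieri_asymptotic_sieve` (`ParityBarrier.lean`): size `X(x) = x`,
`HasSieveDimension g 1 K`, `HasLinearDensity c`, `HasDensityConstant H` and level of distribution
`x^θ` for every `θ < 1` on SQUAREFREE moduli only (`treeLemma10`). The argument avoids prime-power
moduli altogether: write `ζ = x^{θ₀}` and group the `n ≤ x` with `(n, P(z)) > 1` according to the
radical `ρ = rad` of their `ζ`-smooth part (`ρ ∣ P(ζ)` squarefree, `ρ ≠ 1`, least prime `< z`).
* `generalizedVonMangoldt_le_pow_prod_log`: `Λ_c(n) ≤ C_k^{ω(ρ)} (∏_{p ∣ ρ} log p)(log x)^{c−ω(ρ)}`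
  and `Λ_c(n) = 0` unless `ω(ρ) ≤ c` — the coprime Leibniz rule
  (`GeneralizedVonMangoldtCoprime.lean`) and `Λ_i(p^b) ≤ i (log p^b)^{i−1} log p`
  (`generalizedVonMangoldt_primePow_eq`, `generalizedVonMangoldt_primePow_le_mul`); this is where
  the factor `log p/log x` is saved for each small prime `p ∣ n`;
* `sum_filter_rad_smoothPart_le`, `sum_smoothPart_le_sum_rad`: the `n` with radical `ρ` are
  multiples of `ρ` coprime to `P(ζ)/ρ`, a sifted set of `𝒜_ρ`;
* `sifted_restrictDvd_div_le`: Greaves' upper beta-sieve inequality for `𝒜_ρ` and the squarefree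
  sifting modulus `P(ζ)/ρ` at level `D = ζ^{10}` (`SieveSequence.sifted_le_upperSum`,
  `BetaSieve.abs_mainTerm_sub_le`, `BetaSieve.bdry_sum_le` of `SieveFrameworkFundamentalLemma.lean`)
  — all moduli `ρ d` are squarefree and `< ζ^{k+10} = x^{1/2}`;
* `sum_divisors_card_succ_le`, `sum_divisors_card_eq_le_pow`, `sum_rad_weight_density_le`: the main
  terms, `∑_ρ C_k^{ω(ρ)} (∏_{p∣ρ} g(p) log p) L^{c−ω(ρ)} ≪ L^{c−1} ∑_{p<z} g(p) log p` by peeling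
  the least prime (which is `< z`) and `∑_{p<ζ} g(p) log p ≪ log ζ` (`HasLinearDensity`);
* `sum_divisors_sum_le_mul`, `sum_rad_weight_remainder_le`: each squarefree `m` is `ρ d` in at
  most `(log₂ m + 1)^k` ways, so the remainders are `(log x)^{O(k)} ∑_{m < x^{1/2}, μ²(m)=1} |R_m(x)|`;
* `sigma0_bound_at` (everything explicit at one height), `numMain`, `numRem`, `treeLemma10`.

## References

* J. Friedlander, H. Iwaniec, *On Bombieri's asymptotic sieve*, Ann. Scuola Norm. Sup. Pisa
  Cl. Sci. (4) 5 (1978), 719–756, Lemma 10 and §6. [FriedlanderIwaniecPisa1978]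
* E. Bombieri, *The asymptotic sieve*, Rend. Accad. Naz. XL (5) 1/2 (1975/76), 243–269,
  Lemmata 1–2. [BombieriAsymptoticSieve1976]
* G. Greaves, *Sieves in Number Theory*, Springer (2001), §3.3. [Greaves2001]
-/

open Filter Finset Asymptotics
open scoped Topology ArithmeticFunction.Moebius ArithmeticFunction.Omega ArithmeticFunction.omega

noncomputable section

namespace Literature.NumberTheory.Sieve

namespace BombieriSieve

/-! ### `Λ_i` at prime powers, exactly -/

/-- `Λ_i(p^b) = (log p^b)^i − (log p^{b−1})^i` for `b ≥ 1`, `i ≥ 1` (only `d = 1, p` have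
`μ(d) ≠ 0` among the divisors of `p^b`). [folklore] -/
theorem generalizedVonMangoldt_primePow_eq {p : ℕ} (hp : p.Prime) {b i : ℕ} (hb : 1 ≤ b)
    (hi : 1 ≤ i) :
    generalizedVonMangoldt i (p ^ b) =
      Real.log ((p : ℝ) ^ b) ^ i - Real.log ((p : ℝ) ^ (b - 1)) ^ i := by
  rw [generalizedVonMangoldt_apply hi, Nat.sum_divisorsAntidiagonal
    (fun d e => (μ d : ℝ) * Real.log (e : ℝ) ^ i), Nat.divisors_prime_pow hp b, Finset.sum_map]
  simp only [Function.Embedding.coeFn_mk]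
  have hp0 : p ≠ 0 := hp.ne_zero
  -- the terms `j ≥ 2` vanish, `j = 0, 1` give the two logarithms
  have hterm : ∀ j ∈ Finset.range (b + 1), (μ (p ^ j) : ℝ) * Real.log (((p ^ b / p ^ j : ℕ)) : ℝ) ^ i =
      if j = 0 then Real.log ((p : ℝ) ^ b) ^ i else
        if j = 1 then - Real.log ((p : ℝ) ^ (b - 1)) ^ i else 0 := by
    intro j hj
    have hjb : j ≤ b := Nat.lt_succ_iff.mp (Finset.mem_range.mp hj)
    have hdiv : p ^ b / p ^ j = p ^ (b - j) := Nat.pow_div hjb hp.pos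
    rw [hdiv]
    rcases Nat.eq_zero_or_pos j with rfl | hj1
    · simp
    · rw [if_neg hj1.ne', ArithmeticFunction.moebius_apply_prime_pow hp hj1.ne']
      split_ifs with h1
      · subst h1; push_cast; ring
      · simp
  rw [Finset.sum_congr rfl hterm, Finset.sum_ite, Finset.sum_ite]
  have hf0 : (Finset.range (b + 1)).filter (fun j => j = 0) = {0} := by
    ext j; simp only [Finset.mem_filter, Finset.mem_range, Finset.mem_singleton]; omega
  have hf1 : ((Finset.range (b + 1)).filter (fun j => ¬ j = 0)).filter (fun j => j = 1) = {1} := by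
    ext j; simp only [Finset.mem_filter, Finset.mem_range, Finset.mem_singleton]; omega
  rw [hf0, hf1, Finset.sum_singleton, Finset.sum_singleton, Finset.sum_const_zero, add_zero]
  ring

/-- `Λ_i(p^b) ≤ i (log p^b)^{i−1} log p` for `b ≥ 1` (all `i`; at `i = 0` both sides vanish).
[folklore] -/
theorem generalizedVonMangoldt_primePow_le_mul {p : ℕ} (hp : p.Prime) {b : ℕ} (hb : 1 ≤ b)
    (i : ℕ) :
    generalizedVonMangoldt i (p ^ b) ≤ i * Real.log ((p : ℝ) ^ b) ^ (i - 1) * Real.log p := by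
  rcases Nat.eq_zero_or_pos i with rfl | hi
  · rw [generalizedVonMangoldt_zero_apply_of_ne_one]
    · simp
    · exact (Nat.one_lt_pow (by omega) hp.one_lt).ne'
  · rw [generalizedVonMangoldt_primePow_eq hp hb hi]
    have hp1 : (1 : ℝ) < p := by exact_mod_cast hp.one_lt
    have hlogp : 0 ≤ Real.log p := Real.log_nonneg hp1.le
    set u := Real.log ((p : ℝ) ^ b) with hu
    set v := Real.log ((p : ℝ) ^ (b - 1)) with hv
    have huv : u - v = Real.log p := by
      rw [hu, hv, Real.log_pow, Real.log_pow]
      obtain ⟨c, rfl⟩ : ∃ c, b = c + 1 := ⟨b - 1, by omega⟩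
      simp; ring
    have hv0 : 0 ≤ v := by rw [hv, Real.log_pow]; positivity
    have hvu : v ≤ u := by linarith
    have hpow : u ^ i - v ^ i ≤ i * u ^ (i - 1) * (u - v) := by
      have hu0 : 0 ≤ u := hv0.trans hvu
      have hS : ∑ j ∈ Finset.range i, u ^ j * v ^ (i - 1 - j) ≤ i * u ^ (i - 1) := by
        have hterm : ∀ j ∈ Finset.range i, u ^ j * v ^ (i - 1 - j) ≤ u ^ (i - 1) := by
          intro j hj
          have hji : j + (i - 1 - j) = i - 1 := by have := Finset.mem_range.mp hj; omega
          calc u ^ j * v ^ (i - 1 - j) ≤ u ^ j * u ^ (i - 1 - j) :=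
                mul_le_mul_of_nonneg_left (pow_le_pow_left₀ hv0 hvu _) (pow_nonneg hu0 _)
            _ = u ^ (i - 1) := by rw [← pow_add, hji]
        refine (Finset.sum_le_sum hterm).trans ?_
        rw [Finset.sum_const, Finset.card_range, nsmul_eq_mul]
      calc u ^ i - v ^ i = (∑ j ∈ Finset.range i, u ^ j * v ^ (i - 1 - j)) * (u - v) :=
            (geom_sum₂_mul u v i).symm
        _ ≤ i * u ^ (i - 1) * (u - v) := mul_le_mul_of_nonneg_right hS (sub_nonneg.mpr hvu)
    calc u ^ i - v ^ i ≤ i * u ^ (i - 1) * (u - v) := hpow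
      _ = i * u ^ (i - 1) * Real.log p := by rw [huv]

/-! ### `Λ_j` on numbers with few prime factors: saving the logarithms of the primes -/

/-- **`Λ_j(q) ≤ C^{ω(q)} (∏_{p ∣ q} log p) (log x)^{j − ω(q)}`** for `1 ≤ q ≤ x` with `ω(q) ≤ j ≤ k`
(`C = k 2^k + 1`): by induction on `q`, peeling off the least prime power `p^b ∥ q` with the
coprime Leibniz rule (`generalizedVonMangoldt_mul_of_coprime'`) and
`Λ_i(p^b) ≤ i (log p^b)^{i−1} log p` (`generalizedVonMangoldt_primePow_le_mul`); the terms with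
`ω(q/p^b) > j − i` vanish. This is where the asymptotic sieve saves the factor `log p/log x` for
each small prime `p ∣ n` without any information on the distribution of `a_n` in the progressions
to prime-power moduli. [folklore] -/
theorem generalizedVonMangoldt_le_pow_prod_log (k : ℕ) {x : ℝ} (hx : 1 ≤ x) :
    ∀ q : ℕ, q ≠ 0 → (q : ℝ) ≤ x → ∀ j : ℕ, j ≤ k → q.primeFactors.card ≤ j →
      generalizedVonMangoldt j q ≤
        ((k : ℝ) * 2 ^ k + 1) ^ q.primeFactors.card * (∏ p ∈ q.primeFactors, Real.log p) *
          Real.log x ^ (j - q.primeFactors.card) := by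
  have hL : 0 ≤ Real.log x := Real.log_nonneg hx
  set C : ℝ := (k : ℝ) * 2 ^ k + 1 with hC
  have hC1 : 1 ≤ C := by rw [hC]; exact le_add_of_nonneg_left (by positivity)
  intro q
  induction q using Nat.strong_induction_on with
  | _ q ih =>
  intro hq0 hqx j hjk hω
  rcases eq_or_ne q 1 with rfl | hq1
  · -- `q = 1`
    simp only [Nat.primeFactors_one, Finset.card_empty, Finset.prod_empty, pow_zero, one_mul,
      mul_one, Nat.sub_zero]
    rcases Nat.eq_zero_or_pos j with rfl | hj
    · rw [generalizedVonMangoldt_zero_apply_one, pow_zero]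
    · rw [generalizedVonMangoldt_apply_one hj]; positivity
  -- `q > 1`: peel off `p^b`, `p = minFac q`
  set p := q.minFac with hpdef
  have hp : p.Prime := Nat.minFac_prime hq1
  set b := q.factorization p with hbdef
  have hb1 : 1 ≤ b := by
    rw [hbdef]
    exact Nat.Prime.factorization_pos_of_dvd hp hq0 (Nat.minFac_dvd q)
  set q' := q / p ^ b with hq'def
  have hpbq : p ^ b ∣ q := Nat.ordProj_dvd q p
  have hqq : p ^ b * q' = q := Nat.mul_div_cancel' hpbq
  have hq'0 : q' ≠ 0 := by
    intro h; rw [h, mul_zero] at hqq; exact hq0 hqq.symm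
  have hcop : (p ^ b).Coprime q' := by
    rw [hq'def, hbdef]
    exact (Nat.coprime_ordCompl hp hq0).pow_left _
  have hpq' : ¬ p ∣ q' := by
    rw [hq'def, hbdef]; exact Nat.not_dvd_ordCompl hp hq0
  have hq'lt : q' < q := by
    rw [← hqq]
    have : 1 < p ^ b := Nat.one_lt_pow (by omega) hp.one_lt
    exact lt_mul_of_one_lt_left (Nat.pos_of_ne_zero hq'0) this
  have hq'x : (q' : ℝ) ≤ x := le_trans (by exact_mod_cast hq'lt.le) hqx
  -- prime factors
  have hpf : q.primeFactors = insert p q'.primeFactors := by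
    rw [← hqq, Nat.Coprime.primeFactors_mul hcop, Nat.primeFactors_prime_pow (by omega) hp]
    rfl
  have hpmem : p ∉ q'.primeFactors := fun h => hpq' (Nat.dvd_of_mem_primeFactors h)
  have hcard : q.primeFactors.card = q'.primeFactors.card + 1 := by
    rw [hpf, Finset.card_insert_of_notMem hpmem]
  have hprod : ∏ r ∈ q.primeFactors, Real.log r = Real.log p * ∏ r ∈ q'.primeFactors, Real.log r := by
    rw [hpf, Finset.prod_insert hpmem]
  set w := q'.primeFactors.card with hw
  rw [hcard] at hω ⊢
  -- the Leibniz rule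
  have hleib := generalizedVonMangoldt_mul_of_coprime' hcop j
  rw [hqq] at hleib
  rw [hleib]
  -- bound each term
  have hp0 : (0 : ℝ) < p := by exact_mod_cast hp.pos
  have hLpb : Real.log ((p : ℝ) ^ b) ≤ Real.log x := by
    have h1 : ((p ^ b : ℕ) : ℝ) ≤ x := le_trans (by exact_mod_cast Nat.le_of_dvd (Nat.pos_of_ne_zero hq0) hpbq) hqx
    push_cast at h1
    exact Real.log_le_log (by positivity) h1
  have hLpb0 : 0 ≤ Real.log ((p : ℝ) ^ b) := by
    rw [Real.log_pow]; exact mul_nonneg (Nat.cast_nonneg _) (Real.log_nonneg (by exact_mod_cast hp.one_lt.le))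
  have hlogp0 : 0 ≤ Real.log p := Real.log_nonneg (by exact_mod_cast hp.one_lt.le)
  have hP0 : 0 ≤ ∏ r ∈ q'.primeFactors, Real.log r := Finset.prod_nonneg fun r hr =>
    Real.log_nonneg (by exact_mod_cast (Nat.prime_of_mem_primeFactors hr).one_lt.le)
  have hterm : ∀ i ∈ Finset.range (j + 1),
      (j.choose i : ℝ) * (generalizedVonMangoldt i (p ^ b) * generalizedVonMangoldt (j - i) q') ≤
        (j.choose i : ℝ) * i * (C ^ w * (Real.log p * ∏ r ∈ q'.primeFactors, Real.log r) *
          Real.log x ^ (j - (w + 1))) := by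
    intro i hi
    have hij : i ≤ j := Nat.lt_succ_iff.mp (Finset.mem_range.mp hi)
    rw [mul_assoc]
    refine mul_le_mul_of_nonneg_left ?_ (Nat.cast_nonneg _)
    rcases Nat.eq_zero_or_pos i with rfl | hi1
    · rw [generalizedVonMangoldt_zero_apply_of_ne_one (Nat.one_lt_pow (by omega) hp.one_lt).ne']
      simp
    by_cases hwi : w ≤ j - i
    · -- use the induction hypothesis for `q'`
      have hIH := ih q' hq'lt hq'0 hq'x (j - i) (by omega) hwi
      have h1 := generalizedVonMangoldt_primePow_le_mul hp hb1 i
      have hA0 : 0 ≤ generalizedVonMangoldt i (p ^ b) := generalizedVonMangoldt_nonneg _ _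
      have hB0 : 0 ≤ generalizedVonMangoldt (j - i) q' := generalizedVonMangoldt_nonneg _ _
      calc generalizedVonMangoldt i (p ^ b) * generalizedVonMangoldt (j - i) q'
          ≤ (i * Real.log ((p : ℝ) ^ b) ^ (i - 1) * Real.log p) *
              (C ^ w * (∏ r ∈ q'.primeFactors, Real.log r) * Real.log x ^ (j - i - w)) :=
            mul_le_mul h1 hIH hB0 (by positivity)
        _ ≤ (i * Real.log x ^ (i - 1) * Real.log p) *
              (C ^ w * (∏ r ∈ q'.primeFactors, Real.log r) * Real.log x ^ (j - i - w)) := by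
            gcongr
        _ = i * (C ^ w * (Real.log p * ∏ r ∈ q'.primeFactors, Real.log r) *
              (Real.log x ^ (i - 1) * Real.log x ^ (j - i - w))) := by ring
        _ = i * (C ^ w * (Real.log p * ∏ r ∈ q'.primeFactors, Real.log r) *
              Real.log x ^ (j - (w + 1))) := by
            rw [← pow_add]
            congr 3
            omega
    · -- `ω(q') > j − i`: the factor `Λ_{j−i}(q')` vanishes
      push Not at hwi
      rw [generalizedVonMangoldt_eq_zero_of_lt_card_primeFactors (k := j - i) (n := q') hwi,
        mul_zero]
      positivity
  refine (Finset.sum_le_sum hterm).trans ?_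
  rw [← Finset.sum_mul]
  -- `∑_i C(j,i) i ≤ k 2^k ≤ C`
  have hsumi : ∑ i ∈ Finset.range (j + 1), (j.choose i : ℝ) * i ≤ C := by
    have h1 : ∀ i ∈ Finset.range (j + 1), (j.choose i : ℝ) * i ≤ (j.choose i : ℝ) * k := fun i hi =>
      mul_le_mul_of_nonneg_left (by exact_mod_cast (Nat.lt_succ_iff.mp (Finset.mem_range.mp hi)).trans hjk)
        (Nat.cast_nonneg _)
    refine (Finset.sum_le_sum h1).trans ?_
    rw [← Finset.sum_mul]
    have h2 : ∑ i ∈ Finset.range (j + 1), (j.choose i : ℝ) = 2 ^ j := by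
      have := Nat.sum_range_choose j
      exact_mod_cast this
    rw [h2, hC]
    have h3 : (2 : ℝ) ^ j ≤ 2 ^ k := pow_le_pow_right₀ one_le_two hjk
    nlinarith [h3, Nat.cast_nonneg (α := ℝ) k, pow_nonneg (zero_le_two (α := ℝ)) j]
  have hrest0 : 0 ≤ C ^ w * (Real.log p * ∏ r ∈ q'.primeFactors, Real.log r) *
      Real.log x ^ (j - (w + 1)) := by positivity
  calc (∑ i ∈ Finset.range (j + 1), (j.choose i : ℝ) * i) *
        (C ^ w * (Real.log p * ∏ r ∈ q'.primeFactors, Real.log r) * Real.log x ^ (j - (w + 1)))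
      ≤ C * (C ^ w * (Real.log p * ∏ r ∈ q'.primeFactors, Real.log r) * Real.log x ^ (j - (w + 1))) :=
        mul_le_mul_of_nonneg_right hsumi hrest0
    _ = C ^ (w + 1) * (∏ r ∈ q.primeFactors, Real.log r) * Real.log x ^ (j - (w + 1)) := by
        rw [hprod, pow_succ]; ring

/-! ### The upper-bound sieve for the multiples of `ρ` sifted by the primes `< ζ` not dividing `ρ` -/

/-- For squarefree `P = ρ P'`: `d ∣ P'` iff `d ∣ P` and `(d, ρ) = 1`. [folklore] -/
theorem divisors_div_eq_filter {P ρ : ℕ} (hP : Squarefree P) (hρ : ρ ∣ P) :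
    (P / ρ).divisors = P.divisors.filter (fun d : ℕ => d.Coprime ρ) := by
  have hP0 : P ≠ 0 := hP.ne_zero
  have hmul : ρ * (P / ρ) = P := Nat.mul_div_cancel' hρ
  have hsf : Squarefree (ρ * (P / ρ)) := by rwa [hmul]
  have hcop : ρ.Coprime (P / ρ) := (Nat.squarefree_mul_iff.mp hsf).1
  have hP'0 : P / ρ ≠ 0 := fun h => by rw [h, mul_zero] at hmul; exact hP0 hmul.symm
  ext d
  rw [Nat.mem_divisors, Finset.mem_filter, Nat.mem_divisors]
  constructor
  · rintro ⟨hd, -⟩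
    exact ⟨⟨hd.trans (Nat.div_dvd_of_dvd hρ), hP0⟩, (hcop.coprime_dvd_right hd).symm⟩
  · rintro ⟨⟨hd, -⟩, hdρ⟩
    refine ⟨?_, hP'0⟩
    rw [← hmul] at hd
    exact hdρ.dvd_of_dvd_mul_left hd

/-- **Upper-bound sieve for the multiples of `ρ ∣ P(ζ)` sifted by the primes `< ζ` not dividing `ρ`**
(size `X(x) = x`, all moduli `ρ d` squarefree): for `ζ ≥ 2`, `D > 1` with `10 log ζ ≤ log D`
(`s ≥ β = 10`, the beta-sieve range of `BetaSieve.bdry_sum_le`) and `ω(ρ) ≤ k`,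
`∑_{n ≤ x, ρ ∣ n, (n, P(ζ)/ρ) = 1} a_n ≤ (1 + 2K^{10}) (2K)^k g(ρ) x V(ζ) +
∑_{d ∣ P(ζ)/ρ, d < D} |R_{ρd}(x)|`: Greaves' upper beta-sieve inequality
(`SieveSequence.sifted_le_upperSum`) for the squarefree sifting modulus `P(ζ)/ρ`, the main-term
identity and boundary estimate (`BetaSieve.abs_mainTerm_sub_le`, `BetaSieve.bdry_sum_le`) for the
density `g·1_{(·,ρ)=1}` (dimension `1`, constant `K`), and
`∏_{p<ζ, p∤ρ}(1 − g(p)) ≤ (2K)^k V(ζ)` (`prod_primesBelow_not_dvd_le`).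
[cite: Greaves2001, §3.3.4 Thm 1] -/
theorem sifted_restrictDvd_div_le (A : SieveSequence) {K : ℝ} (hK : HasSieveDimension A.density 1 K)
    (hsize : ∀ x, A.size x = x) {ζ D x : ℝ} (hζ : 2 ≤ ζ) (hD1 : 1 < D)
    (hζD : 10 * Real.log ζ ≤ Real.log D) (hx : 0 ≤ x) {ρ k : ℕ} (hρ : ρ ∣ primesProdBelow ζ)
    (hω : ρ.primeFactors.card ≤ k) :
    (A.restrictDvd ρ).sifted x (primesProdBelow ζ / ρ) ≤
      (1 + 2 * K ^ 10) * (2 * K) ^ k * A.density ρ * x * A.densityProduct (primesProdBelow ζ) +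
        ∑ d ∈ (primesProdBelow ζ / ρ).divisors.filter (fun d : ℕ => (d : ℝ) < D),
          |A.remainder (ρ * d) x| := by
  classical
  set P := primesProdBelow ζ with hP
  set P' := P / ρ with hP'
  have hPsf : Squarefree P := hP ▸ squarefree_primesProdBelow ζ
  have hP0 : P ≠ 0 := hPsf.ne_zero
  have hmul : ρ * P' = P := Nat.mul_div_cancel' hρ
  have hsf2 : Squarefree (ρ * P') := by rwa [hmul]
  obtain ⟨hρP', hρsf, hP'sf⟩ := Nat.squarefree_mul_iff.mp hsf2
  have hρ0 : ρ ≠ 0 := hρsf.ne_zero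
  have hK1 : 1 ≤ K := hK.one_le
  have hg0 : ∀ p : ℕ, p.Prime → 0 ≤ A.density p := fun p hp => (hK.1 p hp).1
  have hgρ : 0 ≤ A.density ρ := by
    rw [BetaSieve.map_eq_prod_primeFactors A.density_mult hρsf]
    exact Finset.prod_nonneg fun p hp => hg0 p (Nat.prime_of_mem_primeFactors hp)
  -- the density off `ρ`
  set g' : ArithmeticFunction ℝ :=
    ⟨fun d => if d.Coprime ρ then A.density d else 0, by
      show (if (0 : ℕ).Coprime ρ then A.density 0 else 0) = 0
      split_ifs <;> simp [ArithmeticFunction.map_zero]⟩ with hg'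
  have hg'_apply : ∀ d, g' d = if d.Coprime ρ then A.density d else 0 := fun d => rfl
  have hg'_mult : g'.IsMultiplicative := by
    refine ⟨?_, ?_⟩
    · rw [hg'_apply, if_pos (Nat.coprime_one_left ρ), A.density_mult.map_one]
    · intro m n hmn
      rw [hg'_apply, hg'_apply, hg'_apply]
      by_cases hm : m.Coprime ρ
      · by_cases hn : n.Coprime ρ
        · rw [if_pos (Nat.Coprime.mul_left hm hn), if_pos hm, if_pos hn,
            A.density_mult.map_mul_of_coprime hmn]
        · rw [if_neg (fun h => hn (Nat.Coprime.coprime_mul_left h)), if_neg hn, mul_zero]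
      · rw [if_neg (fun h => hm (Nat.Coprime.coprime_mul_right h)), if_neg hm, zero_mul]
  have hK' : HasSieveDimension g' 1 K := by
    refine ⟨fun p hp => ?_, fun w z hw hwz => le_trans ?_ (hK.2 w z hw hwz)⟩
    · rw [hg'_apply]
      split_ifs
      · exact hK.1 p hp
      · exact ⟨le_rfl, zero_lt_one⟩
    · refine Finset.prod_le_prod (fun p hp => inv_nonneg.mpr (sub_nonneg.mpr ?_)) fun p hp => ?_
      · rw [hg'_apply]
        split_ifs
        · exact (hK.1 p (Nat.prime_of_mem_primesBelow (Finset.mem_filter.mp hp).1)).2.le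
        · exact zero_le_one
      · have hpp := Nat.prime_of_mem_primesBelow (Finset.mem_filter.mp hp).1
        rw [hg'_apply]
        split_ifs
        · exact le_rfl
        · rw [sub_zero, inv_one, one_le_inv_iff₀]
          exact ⟨sub_pos.mpr (hK.1 p hpp).2, sub_le_self _ (hK.1 p hpp).1⟩
  have h01 : ∀ p ∈ P.primeFactors, 0 ≤ g' p ∧ g' p ≤ 1 := fun p hp =>
    ⟨(hK'.1 p (Nat.prime_of_mem_primeFactors hp)).1, (hK'.1 p (Nat.prime_of_mem_primeFactors hp)).2.le⟩
  have hg'nn : ∀ t ∈ P.divisors, 0 ≤ g' t := by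
    intro t ht
    have htsf : Squarefree t := hPsf.squarefree_of_dvd (Nat.dvd_of_mem_divisors ht)
    rw [BetaSieve.map_eq_prod_primeFactors hg'_mult htsf]
    exact Finset.prod_nonneg fun p hp => (hK'.1 p (Nat.prime_of_mem_primeFactors hp)).1
  -- Step 1: the upper sieve inequality for `B = restrictDvd ρ` and the modulus `P'`
  set B := A.restrictDvd ρ with hB
  have hup := SieveSequence.sifted_le_upperSum B (β := 10) (D := D) x hP'sf
  -- Step 2: the congruence sums of `B`
  have hcongr : ∀ d ∈ P'.divisors, B.congrSum d x =
      A.density ρ * x * A.density d + A.remainder (ρ * d) x := by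
    intro d hd
    have hdP' : d ∣ P' := Nat.dvd_of_mem_divisors hd
    have hρd : ρ.Coprime d := hρP'.coprime_dvd_right hdP'
    have h1 : B.remainder d x = A.remainder (ρ * d) x := remainder_restrictDvd A hρd x
    have h2 : B.remainder d x = B.congrSum d x - B.density d * B.size x := rfl
    have h3 : B.size x = A.density ρ * A.size x := rfl
    have h4 : B.density d = A.density d := rfl
    rw [h2, h3, h4, hsize] at h1
    linarith
  have hsum : ∑ d ∈ P'.divisors, (μ d : ℝ) * BetaSieve.ind 1 10 D d * B.congrSum d x =
      A.density ρ * x * ∑ d ∈ P'.divisors, (μ d : ℝ) * BetaSieve.ind 1 10 D d * A.density d +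
        ∑ d ∈ P'.divisors, (μ d : ℝ) * BetaSieve.ind 1 10 D d * A.remainder (ρ * d) x := by
    rw [Finset.mul_sum, ← Finset.sum_add_distrib]
    refine Finset.sum_congr rfl fun d hd => ?_
    rw [hcongr d hd]; ring
  -- Step 3: the main term via the density off `ρ`
  have hmain_eq : ∑ d ∈ P'.divisors, (μ d : ℝ) * BetaSieve.ind 1 10 D d * A.density d =
      ∑ d ∈ P.divisors, (μ d : ℝ) * BetaSieve.ind 1 10 D d * g' d := by
    rw [hP', divisors_div_eq_filter hPsf hρ, Finset.sum_filter]
    refine Finset.sum_congr rfl fun d _ => ?_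
    rw [hg'_apply]
    split_ifs <;> simp
  have hmain_le : ∑ d ∈ P.divisors, (μ d : ℝ) * BetaSieve.ind 1 10 D d * g' d ≤
      (1 + 2 * K ^ 10) * BetaSieve.vprod g' P := by
    have h1 := BetaSieve.abs_mainTerm_sub_le (par := 1) (β := 10) (D := D) hg'_mult hPsf hg'nn
      (BetaSieve.vlt_nonneg h01)
    have h2 := BetaSieve.bdry_sum_le (par := 1) (β := 10) (D := D) hg'_mult hK' one_pos hζ hD1
      (by norm_num) (by linarith)
    rw [← hP] at h2
    have hV0 : 0 ≤ BetaSieve.vprod g' P := BetaSieve.vprod_nonneg h01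
    have hexp : Real.exp (10 - Real.log D / Real.log ζ) ≤ 1 := by
      rw [Real.exp_le_one_iff, sub_nonpos, le_div_iff₀ (Real.log_pos (by linarith))]
      linarith
    have h3 : ∑ t ∈ P.divisors, BetaSieve.bdry 1 10 D t * g' t * BetaSieve.vlt g' P t.minFac ≤
        2 * K ^ 10 * BetaSieve.vprod g' P :=
      h2.trans (by
        calc 2 * K ^ 10 * Real.exp (10 - Real.log D / Real.log ζ) * BetaSieve.vprod g' P
            ≤ 2 * K ^ 10 * 1 * BetaSieve.vprod g' P := by gcongr
          _ = 2 * K ^ 10 * BetaSieve.vprod g' P := by ring)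
    have h4 := (abs_sub_le_iff.mp h1).1
    linarith
  have hvprod : BetaSieve.vprod g' P ≤ (2 * K) ^ k * A.densityProduct P := by
    rw [BetaSieve.vprod, SieveSequence.densityProduct, hP, primeFactors_primesProdBelow]
    have hsplit : ∏ p ∈ Nat.primesBelow ⌈ζ⌉₊, (1 - g' p) =
        ∏ p ∈ (Nat.primesBelow ⌈ζ⌉₊).filter (fun p : ℕ => ¬ p ∣ ρ), (1 - A.density p) := by
      rw [← Finset.prod_filter_mul_prod_filter_not (Nat.primesBelow ⌈ζ⌉₊) (fun p : ℕ => ¬ p ∣ ρ)]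
      have h2 : ∏ p ∈ (Nat.primesBelow ⌈ζ⌉₊).filter (fun p : ℕ => ¬ ¬ p ∣ ρ), (1 - g' p) = 1 := by
        refine Finset.prod_eq_one fun p hp => ?_
        obtain ⟨hp', hpq⟩ := Finset.mem_filter.mp hp
        rw [not_not] at hpq
        have hpp := Nat.prime_of_mem_primesBelow hp'
        rw [hg'_apply, if_neg, sub_zero]
        exact fun hc => hpp.one_lt.ne' (Nat.Coprime.eq_one_of_dvd hc hpq)
      rw [h2, mul_one]
      refine Finset.prod_congr rfl fun p hp => ?_
      obtain ⟨hp', hpq⟩ := Finset.mem_filter.mp hp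
      have hpp := Nat.prime_of_mem_primesBelow hp'
      rw [hg'_apply, if_pos ((Nat.Prime.coprime_iff_not_dvd hpp).mpr hpq)]
    rw [hsplit]
    exact prod_primesBelow_not_dvd_le hK hω hρ0 ⌈ζ⌉₊
  -- Step 4: the remainders: `ind(d) ∈ {0, 1}` and `ind(d) = 1 ⇒ d < D`
  have hrem : ∑ d ∈ P'.divisors, (μ d : ℝ) * BetaSieve.ind 1 10 D d * A.remainder (ρ * d) x ≤
      ∑ d ∈ P'.divisors.filter (fun d : ℕ => (d : ℝ) < D), |A.remainder (ρ * d) x| := by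
    rw [Finset.sum_filter]
    refine Finset.sum_le_sum fun d hd => ?_
    have hdP' : d ∣ P' := Nat.dvd_of_mem_divisors hd
    have hdP : d ∣ P := hdP'.trans (Nat.div_dvd_of_dvd hρ)
    have hdsf : Squarefree d := hPsf.squarefree_of_dvd hdP
    by_cases hpred : BetaSieve.pred 1 10 D d
    · have hlt : (d : ℝ) < D :=
        BetaSieve.lt_level_of_pred (by norm_num) hD1 (by linarith) hdsf
          (fun p hp => BetaSieve.prime_lt_of_mem_primeFactors_of_dvd (hP ▸ hdP) hp) hpred
      rw [if_pos hlt, BetaSieve.ind_of_pred hpred, mul_one]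
      have hμ : |(μ d : ℝ)| ≤ 1 := by exact_mod_cast ArithmeticFunction.abs_moebius_le_one
      calc (μ d : ℝ) * A.remainder (ρ * d) x ≤ |(μ d : ℝ) * A.remainder (ρ * d) x| := le_abs_self _
        _ = |(μ d : ℝ)| * |A.remainder (ρ * d) x| := abs_mul _ _
        _ ≤ 1 * |A.remainder (ρ * d) x| := mul_le_mul_of_nonneg_right hμ (abs_nonneg _)
        _ = |A.remainder (ρ * d) x| := one_mul _
    · rw [BetaSieve.ind_of_not_pred hpred, mul_zero, zero_mul]
      split_ifs
      · exact abs_nonneg _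
      · exact le_rfl
  -- assembling
  have hV0 : 0 ≤ A.densityProduct P := by
    rw [SieveSequence.densityProduct, hP, primeFactors_primesProdBelow]
    exact Finset.prod_nonneg fun p hp =>
      sub_nonneg.mpr (hK.1 p (Nat.prime_of_mem_primesBelow hp)).2.le
  calc B.sifted x P' ≤ _ := hup
    _ = A.density ρ * x * ∑ d ∈ P'.divisors, (μ d : ℝ) * BetaSieve.ind 1 10 D d * A.density d +
          ∑ d ∈ P'.divisors, (μ d : ℝ) * BetaSieve.ind 1 10 D d * A.remainder (ρ * d) x := hsum
    _ ≤ A.density ρ * x * ((1 + 2 * K ^ 10) * ((2 * K) ^ k * A.densityProduct P)) +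
          ∑ d ∈ P'.divisors.filter (fun d : ℕ => (d : ℝ) < D), |A.remainder (ρ * d) x| := by
        refine add_le_add (mul_le_mul_of_nonneg_left ?_ (mul_nonneg hgρ hx)) hrem
        rw [hmain_eq]
        exact hmain_le.trans (mul_le_mul_of_nonneg_left hvprod (by positivity))
    _ = (1 + 2 * K ^ 10) * (2 * K) ^ k * A.density ρ * x * A.densityProduct P +
          ∑ d ∈ P'.divisors.filter (fun d : ℕ => (d : ℝ) < D), |A.remainder (ρ * d) x| := by ring

/-! ### Peeling sums over squarefree numbers with a prescribed number of prime factors -/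

/-- One peeling step: `∑_{ρ ∣ P, ω(ρ) = w+1, minFac ρ < X} ∏_{p∣ρ} h(p) ≤
(∑_{p ∣ P, p < X} h(p)) · ∑_{ρ' ∣ P, ω(ρ') = w} ∏_{p∣ρ'} h(p)` (`P` squarefree, `h ≥ 0`), via the
injection `ρ ↦ (minFac ρ, ρ/minFac ρ)`. [folklore] -/
theorem sum_divisors_card_succ_le {P : ℕ} (hP : Squarefree P) (h : ℕ → ℝ)
    (hh0 : ∀ p ∈ P.primeFactors, 0 ≤ h p) (X w : ℕ) :
    ∑ ρ ∈ P.divisors.filter (fun ρ : ℕ => ρ.primeFactors.card = w + 1 ∧ ρ.minFac < X),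
        ∏ p ∈ ρ.primeFactors, h p ≤
      (∑ p ∈ P.primeFactors.filter (· < X), h p) *
        ∑ ρ ∈ P.divisors.filter (fun ρ : ℕ => ρ.primeFactors.card = w), ∏ p ∈ ρ.primeFactors, h p := by
  set S := P.divisors.filter (fun ρ : ℕ => ρ.primeFactors.card = w + 1 ∧ ρ.minFac < X) with hS
  set T := (P.primeFactors.filter (· < X)) ×ˢ
    P.divisors.filter (fun ρ : ℕ => ρ.primeFactors.card = w) with hT
  have hP0 : P ≠ 0 := hP.ne_zero
  -- facts about `ρ ∈ S`
  have hfacts : ∀ ρ ∈ S, ρ ≠ 1 ∧ Squarefree ρ ∧ ρ ∣ P ∧ ρ.minFac.Prime ∧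
      (ρ / ρ.minFac).primeFactors.card = w ∧
      ρ.primeFactors = insert ρ.minFac (ρ / ρ.minFac).primeFactors ∧
      ρ.minFac ∉ (ρ / ρ.minFac).primeFactors := by
    intro ρ hρ
    obtain ⟨hρ, hcard, -⟩ := Finset.mem_filter.mp hρ
    have hρP : ρ ∣ P := Nat.dvd_of_mem_divisors hρ
    have hρsf : Squarefree ρ := hP.squarefree_of_dvd hρP
    have hρ1 : ρ ≠ 1 := by
      intro h; rw [h] at hcard; simp at hcard
    have hp := Nat.minFac_prime hρ1
    have hρ0 : ρ ≠ 0 := hρsf.ne_zero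
    have hd0 : ρ / ρ.minFac ≠ 0 := by
      intro h0
      have := Nat.div_mul_cancel (Nat.minFac_dvd ρ)
      rw [h0, zero_mul] at this
      exact hρ0 this.symm
    have hnot : ¬ ρ.minFac ∣ ρ / ρ.minFac := BetaSieve.not_minFac_dvd_div hρsf hρ1
    have hpf : ρ.primeFactors = insert ρ.minFac (ρ / ρ.minFac).primeFactors := by
      conv_lhs => rw [← Nat.div_mul_cancel (Nat.minFac_dvd ρ)]
      rw [BetaSieve.primeFactors_mul_prime hp hd0, Finset.union_comm]
      rfl
    have hmem : ρ.minFac ∉ (ρ / ρ.minFac).primeFactors := fun h =>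
      hnot (Nat.dvd_of_mem_primeFactors h)
    have hcard' : (ρ / ρ.minFac).primeFactors.card = w := by
      rw [hpf, Finset.card_insert_of_notMem hmem] at hcard
      omega
    exact ⟨hρ1, hρsf, hρP, hp, hcard', hpf, hmem⟩
  -- the map and its properties
  have hmaps : ∀ ρ ∈ S, (ρ.minFac, ρ / ρ.minFac) ∈ T := by
    intro ρ hρ
    obtain ⟨hρ1, hρsf, hρP, hp, hcard', -, -⟩ := hfacts ρ hρ
    obtain ⟨-, -, hlt⟩ := Finset.mem_filter.mp hρ
    rw [hT, Finset.mem_product, Finset.mem_filter, Finset.mem_filter]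
    refine ⟨⟨Nat.mem_primeFactors.mpr ⟨hp, (Nat.minFac_dvd ρ).trans hρP, hP0⟩, hlt⟩,
      Nat.mem_divisors.mpr ⟨(Nat.div_dvd_of_dvd (Nat.minFac_dvd ρ)).trans hρP, hP0⟩, hcard'⟩
  have hinj : Set.InjOn (fun ρ : ℕ => (ρ.minFac, ρ / ρ.minFac)) ↑S := by
    intro ρ hρ ρ' hρ' heq
    simp only [Prod.mk.injEq] at heq
    obtain ⟨h1, h2⟩ := heq
    have e1 : ρ = ρ / ρ.minFac * ρ.minFac := (Nat.div_mul_cancel (Nat.minFac_dvd ρ)).symm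
    have e2 : ρ' = ρ' / ρ'.minFac * ρ'.minFac := (Nat.div_mul_cancel (Nat.minFac_dvd ρ')).symm
    rw [e1, e2, h2, h1]
  have hval : ∀ ρ ∈ S, ∏ p ∈ ρ.primeFactors, h p =
      h ρ.minFac * ∏ p ∈ (ρ / ρ.minFac).primeFactors, h p := by
    intro ρ hρ
    obtain ⟨-, -, -, -, -, hpf, hmem⟩ := hfacts ρ hρ
    rw [hpf, Finset.prod_insert hmem]
  -- nonnegativity on `T`
  have hTnn : ∀ t ∈ T, 0 ≤ h t.1 * ∏ p ∈ t.2.primeFactors, h p := by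
    intro t ht
    rw [hT, Finset.mem_product, Finset.mem_filter, Finset.mem_filter] at ht
    refine mul_nonneg (hh0 _ ht.1.1) (Finset.prod_nonneg fun p hp => hh0 p ?_)
    exact Nat.primeFactors_mono (Nat.dvd_of_mem_divisors ht.2.1) hP0 hp
  calc ∑ ρ ∈ S, ∏ p ∈ ρ.primeFactors, h p
      = ∑ ρ ∈ S, (fun t : ℕ × ℕ => h t.1 * ∏ p ∈ t.2.primeFactors, h p) (ρ.minFac, ρ / ρ.minFac) :=
        Finset.sum_congr rfl fun ρ hρ => hval ρ hρ
    _ = ∑ t ∈ S.image (fun ρ : ℕ => (ρ.minFac, ρ / ρ.minFac)),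
          h t.1 * ∏ p ∈ t.2.primeFactors, h p :=
        (Finset.sum_image (f := fun t : ℕ × ℕ => h t.1 * ∏ p ∈ t.2.primeFactors, h p) hinj).symm
    _ ≤ ∑ t ∈ T, h t.1 * ∏ p ∈ t.2.primeFactors, h p :=
        Finset.sum_le_sum_of_subset_of_nonneg (Finset.image_subset_iff.mpr hmaps)
          fun t ht _ => hTnn t ht
    _ = _ := by rw [hT, Finset.sum_product, Finset.sum_mul_sum]

/-- `∑_{ρ ∣ P, ω(ρ) = w} ∏_{p∣ρ} h(p) ≤ (∑_{p ∣ P} h(p))^w` (`P` squarefree, `h ≥ 0`). [folklore] -/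
theorem sum_divisors_card_eq_le_pow {P : ℕ} (hP : Squarefree P) (h : ℕ → ℝ)
    (hh0 : ∀ p ∈ P.primeFactors, 0 ≤ h p) (w : ℕ) :
    ∑ ρ ∈ P.divisors.filter (fun ρ : ℕ => ρ.primeFactors.card = w), ∏ p ∈ ρ.primeFactors, h p ≤
      (∑ p ∈ P.primeFactors, h p) ^ w := by
  have hP0 : P ≠ 0 := hP.ne_zero
  induction w with
  | zero =>
    have hset : P.divisors.filter (fun ρ : ℕ => ρ.primeFactors.card = 0) = {1} := by
      ext ρ
      rw [Finset.mem_filter, Finset.mem_singleton, Nat.mem_divisors, Finset.card_eq_zero,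
        Nat.primeFactors_eq_empty]
      constructor
      · rintro ⟨⟨hρ, -⟩, h0 | h1⟩
        · exact absurd (Nat.eq_zero_of_zero_dvd (h0 ▸ hρ)) hP0
        · exact h1
      · rintro rfl; exact ⟨⟨one_dvd P, hP0⟩, Or.inr rfl⟩
    rw [hset, Finset.sum_singleton, Nat.primeFactors_one, Finset.prod_empty, pow_zero]
  | succ w ih =>
    have hset : P.divisors.filter (fun ρ : ℕ => ρ.primeFactors.card = w + 1) =
        P.divisors.filter (fun ρ : ℕ => ρ.primeFactors.card = w + 1 ∧ ρ.minFac < P + 1) := by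
      refine Finset.filter_congr fun ρ hρ => ⟨fun h => ⟨h, ?_⟩, fun h => h.1⟩
      have hρP := Nat.le_of_dvd (Nat.pos_of_ne_zero hP0) (Nat.dvd_of_mem_divisors hρ)
      exact Nat.lt_succ_of_le ((Nat.minFac_le (Nat.pos_of_mem_divisors hρ)).trans hρP)
    rw [hset]
    refine (sum_divisors_card_succ_le hP h hh0 (P + 1) w).trans ?_
    have hfilter : P.primeFactors.filter (· < P + 1) = P.primeFactors :=
      Finset.filter_true_of_mem fun p hp => Nat.lt_succ_of_le (Nat.le_of_mem_primeFactors hp)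
    rw [hfilter, pow_succ, mul_comm]
    exact mul_le_mul_of_nonneg_right ih (Finset.sum_nonneg hh0)

/-! ### Counting the representations `m = ρ d` -/

/-- **Multiplicity of the moduli `m = ρ d`**: for `P` squarefree, nonnegative `f`, and finite sets
`Dv ρ` of divisors of `P/ρ` with all `ρ d ∈ T ⊆ [1, X]`,
`∑_{ρ ∣ P, ω(ρ) ≤ k} ∑_{d ∈ Dv ρ} f(ρ d) ≤ (log₂ X + 1)^k ∑_{m ∈ T} f(m)`: a squarefree `m` has at
most `(ω(m)+1)^k` divisors `ρ` with `ω(ρ) ≤ k` (`card_powerset_filter_card_le`), and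
`ω(m) ≤ log₂ m` (`card_primeFactors_le_log`). [folklore] -/
theorem sum_divisors_sum_le_mul {P : ℕ} (hP : Squarefree P) (k : ℕ) (f : ℕ → ℝ)
    (hf : ∀ m, 0 ≤ f m) (Dv : ℕ → Finset ℕ)
    (hDv : ∀ ρ ∈ P.divisors, ∀ d ∈ Dv ρ, d ∣ P / ρ) (T : Finset ℕ)
    (hT : ∀ ρ ∈ P.divisors.filter (fun ρ : ℕ => ρ.primeFactors.card ≤ k), ∀ d ∈ Dv ρ, ρ * d ∈ T)
    (X : ℕ) (hX : ∀ m ∈ T, m ≤ X) :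
    ∑ ρ ∈ P.divisors.filter (fun ρ : ℕ => ρ.primeFactors.card ≤ k), ∑ d ∈ Dv ρ, f (ρ * d) ≤
      (((Nat.log 2 X + 1) ^ k : ℕ) : ℝ) * ∑ m ∈ T, f m := by
  set Rk := P.divisors.filter (fun ρ : ℕ => ρ.primeFactors.card ≤ k) with hRk
  set S := Rk.sigma Dv with hS
  have hP0 : P ≠ 0 := hP.ne_zero
  have hsigma : ∑ ρ ∈ Rk, ∑ d ∈ Dv ρ, f (ρ * d) = ∑ s ∈ S, f (s.1 * s.2) := by
    rw [hS, Finset.sum_sigma]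
  rw [hsigma, ← Finset.sum_fiberwise_of_maps_to
    (s := S) (t := T) (g := fun s => s.1 * s.2) (fun s hs => ?_)]
  swap
  · rw [hS, Finset.mem_sigma] at hs
    exact hT s.1 hs.1 s.2 hs.2
  rw [Finset.mul_sum]
  refine Finset.sum_le_sum fun m hm => ?_
  have hinner : ∑ s ∈ S.filter (fun s => s.1 * s.2 = m), f (s.1 * s.2) =
      (S.filter (fun s => s.1 * s.2 = m)).card * f m := by
    rw [Finset.sum_congr rfl (fun s hs => by rw [(Finset.mem_filter.mp hs).2]), Finset.sum_const,
      nsmul_eq_mul]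
  rw [hinner]
  refine mul_le_mul_of_nonneg_right ?_ (hf m)
  -- the fiber injects into the small subsets of `primeFactors m`
  rcases Nat.eq_zero_or_pos m with rfl | hm0
  · -- `m = 0` cannot occur (`ρ d ≠ 0`), the fiber is empty
    have : S.filter (fun s => s.1 * s.2 = 0) = ∅ := by
      refine Finset.filter_false_of_mem fun s hs h0 => ?_
      rw [hS, Finset.mem_sigma] at hs
      have hρ := (Finset.mem_filter.mp hs.1).1
      have hρ0 : s.1 ≠ 0 := Nat.ne_of_gt (Nat.pos_of_mem_divisors hρ)
      have hdP := hDv s.1 hρ s.2 hs.2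
      have hd0 : s.2 ≠ 0 := by
        intro h
        rw [h] at hdP
        have := Nat.eq_zero_of_zero_dvd hdP
        have hmul := Nat.div_mul_cancel (Nat.dvd_of_mem_divisors hρ)
        rw [this, zero_mul] at hmul
        exact hP0 hmul.symm
      exact mul_ne_zero hρ0 hd0 h0
    rw [this]; simp only [Finset.card_empty, Nat.cast_zero]; positivity
  have hcard : (S.filter (fun s => s.1 * s.2 = m)).card ≤
      (m.primeFactors.powerset.filter (fun F => F.card ≤ k)).card := by
    refine Finset.card_le_card_of_injOn (fun s => s.1.primeFactors) (fun s hs => ?_) ?_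
    · rw [Finset.mem_coe, Finset.mem_filter] at hs
      obtain ⟨hs, hsm⟩ := hs
      rw [hS, Finset.mem_sigma] at hs
      obtain ⟨hρ, hωρ⟩ := Finset.mem_filter.mp hs.1
      rw [Finset.mem_coe, Finset.mem_filter, Finset.mem_powerset]
      exact ⟨Nat.primeFactors_mono ⟨s.2, hsm.symm⟩ hm0.ne', hωρ⟩
    · intro s hs s' hs' heq
      rw [Finset.mem_coe, Finset.mem_filter] at hs hs'
      obtain ⟨hs, hsm⟩ := hs
      obtain ⟨hs', hsm'⟩ := hs'
      rw [hS, Finset.mem_sigma] at hs hs'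
      have hρ := (Finset.mem_filter.mp hs.1).1
      have hρ' := (Finset.mem_filter.mp hs'.1).1
      have hsf : Squarefree s.1 := hP.squarefree_of_dvd (Nat.dvd_of_mem_divisors hρ)
      have hsf' : Squarefree s'.1 := hP.squarefree_of_dvd (Nat.dvd_of_mem_divisors hρ')
      have h1 : s.1 = s'.1 := by
        rw [← Nat.prod_primeFactors_of_squarefree hsf, ← Nat.prod_primeFactors_of_squarefree hsf']
        exact Finset.prod_congr heq fun _ _ => rfl
      have hρ0 : s.1 ≠ 0 := Nat.ne_of_gt (Nat.pos_of_mem_divisors hρ)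
      have h2 : s.2 = s'.2 := by
        have : s.1 * s.2 = s.1 * s'.2 := by rw [hsm, h1, hsm']
        exact Nat.eq_of_mul_eq_mul_left (Nat.pos_of_ne_zero hρ0) this
      exact Sigma.ext h1 (heq_of_eq h2)
  calc ((S.filter (fun s => s.1 * s.2 = m)).card : ℝ)
      ≤ ((m.primeFactors.powerset.filter (fun F => F.card ≤ k)).card : ℝ) := by exact_mod_cast hcard
    _ ≤ (((m.primeFactors.card + 1) ^ k : ℕ) : ℝ) := by
        exact_mod_cast card_powerset_filter_card_le m.primeFactors k
    _ ≤ (((Nat.log 2 X + 1) ^ k : ℕ) : ℝ) := by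
        have h1 := card_primeFactors_le_log m
        have h2 : Nat.log 2 m ≤ Nat.log 2 X := Nat.log_mono_right (hX m hm)
        exact_mod_cast Nat.pow_le_pow_left (by omega) k

/-! ### Grouping the non-rough `n` by the radical of their smooth part -/

/-- The sets `{n ≤ x : rad(smoothPart B n) = ρ}` are sifted sets: if the smooth part of `n` has
prime factors exactly those of the squarefree `ρ ∣ P(ζ)` (`B = ⌈ζ⌉`), then `ρ ∣ n` and
`(n, P(ζ)/ρ) = 1`; hence their `a`-mass is at most `∑_{n ≤ x, ρ ∣ n, (n, P(ζ)/ρ)=1} a_n`, the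
sifted sum of `𝒜_ρ` for the modulus `P(ζ)/ρ`. [folklore] -/
theorem sum_filter_rad_smoothPart_le (A : SieveSequence) {ζ x : ℝ} {ρ : ℕ}
    (hρ : ρ ∣ primesProdBelow ζ) (Q : Finset ℕ) :
    ∑ q ∈ Q.filter (fun q : ℕ => ∏ p ∈ q.primeFactors, p = ρ),
        ∑ n ∈ (Ioc 0 ⌊x⌋₊).filter (fun n : ℕ => smoothPart ⌈ζ⌉₊ n = q), A.a n ≤
      (A.restrictDvd ρ).sifted x (primesProdBelow ζ / ρ) := by
  set P := primesProdBelow ζ with hP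
  set B := ⌈ζ⌉₊ with hB
  have hPsf : Squarefree P := hP ▸ squarefree_primesProdBelow ζ
  have hmul : ρ * (P / ρ) = P := Nat.mul_div_cancel' hρ
  have hsf2 : Squarefree (ρ * (P / ρ)) := by rwa [hmul]
  obtain ⟨hρP', hρsf, -⟩ := Nat.squarefree_mul_iff.mp hsf2
  -- the union over `q` is a single set of `n`
  set s := (Ioc 0 ⌊x⌋₊).filter (fun n : ℕ => smoothPart B n ∈ Q.filter
    (fun q : ℕ => ∏ p ∈ q.primeFactors, p = ρ)) with hs
  have hunion : ∑ q ∈ Q.filter (fun q : ℕ => ∏ p ∈ q.primeFactors, p = ρ),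
      ∑ n ∈ (Ioc 0 ⌊x⌋₊).filter (fun n : ℕ => smoothPart B n = q), A.a n = ∑ n ∈ s, A.a n := by
    rw [← Finset.sum_fiberwise_of_maps_to (s := s) (t := Q.filter
      (fun q : ℕ => ∏ p ∈ q.primeFactors, p = ρ)) (g := smoothPart B)
      (fun n hn => (Finset.mem_filter.mp hn).2)]
    refine Finset.sum_congr rfl fun q hq => Finset.sum_congr ?_ fun _ _ => rfl
    ext n
    rw [Finset.mem_filter, hs, Finset.mem_filter, Finset.mem_filter]
    constructor
    · rintro ⟨hn, hq'⟩; exact ⟨⟨hn, hq' ▸ hq⟩, hq'⟩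
    · rintro ⟨⟨hn, -⟩, hq'⟩; exact ⟨hn, hq'⟩
  rw [hunion]
  -- the sifted sum of `𝒜_ρ`
  have hsift : (A.restrictDvd ρ).sifted x (P / ρ) =
      ∑ n ∈ (Ioc 0 ⌊x⌋₊).filter (fun n : ℕ => n.Coprime (P / ρ) ∧ ρ ∣ n), A.a n := by
    rw [SieveSequence.sifted]
    show ∑ n ∈ (Ioc 0 ⌊x⌋₊).filter (fun n : ℕ => n.Coprime (P / ρ)),
      (if ρ ∣ n then A.a n else 0) = _
    rw [Finset.sum_ite, Finset.sum_const_zero, add_zero, Finset.filter_filter]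
  rw [hsift]
  refine Finset.sum_le_sum_of_subset_of_nonneg (fun n hn => ?_) fun n _ _ => A.a_nonneg n
  rw [hs, Finset.mem_filter, Finset.mem_filter] at hn
  obtain ⟨hn, -, hrad⟩ := hn
  have hn0 : n ≠ 0 := (Finset.mem_Ioc.mp hn).1.ne'
  rw [Finset.mem_filter]
  have hqn : smoothPart B n ∣ n := smoothPart_dvd hn0 B
  have hρq : ρ ∣ smoothPart B n := hrad ▸ Nat.prod_primeFactors_dvd (smoothPart B n)
  refine ⟨hn, ?_, hρq.trans hqn⟩
  -- `(n, P/ρ) = 1`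
  refine Nat.coprime_of_dvd fun p hp hpn hpP' => ?_
  have hpP : p ∣ P := hpP'.trans (Nat.div_dvd_of_dvd hρ)
  have hpζ : (p : ℝ) < ζ := (dvd_primesProdBelow_iff hp ζ).mp (hP ▸ hpP)
  have hpB : p < B := Nat.lt_ceil.mpr hpζ
  have hpq : p ∣ smoothPart B n := (prime_dvd_smoothPart_iff hp hpB hn0).mpr hpn
  have hpρ : p ∣ ρ := by
    have : p ∈ (smoothPart B n).primeFactors :=
      Nat.mem_primeFactors.mpr ⟨hp, hpq, smoothPart_ne_zero B n⟩
    rw [← hrad]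
    exact Finset.dvd_prod_of_mem _ this
  exact (Nat.Prime.one_lt hp).ne' (Nat.Coprime.eq_one_of_dvd (hρP'.coprime_dvd_left hpρ) hpP')

/-! ### `Σ₀`: from the smooth parts to the radicals -/

/-- **Steps 2–3 of the `Σ₀`-bound**: for `c ≤ k`, `x ≥ 1`, `B = ⌈ζ⌉`,
`∑_{q ∈ Qset} Λ_c(q) M(q) ≤ ∑_{ρ ∣ P(ζ), ρ ≠ 1, minFac ρ < ⌈z⌉} W_c(ρ) · S(𝒜_ρ, P(ζ)/ρ; x)`, where
`W_c(ρ) = C_k^{ω(ρ)} (∏_{p∣ρ} log p) L^{c−ω(ρ)}` for `ω(ρ) ≤ c` and `0` otherwise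
(`generalizedVonMangoldt_le_pow_prod_log`, grouping by `ρ = rad q`, `sum_filter_rad_smoothPart_le`).
[folklore] -/
theorem sum_smoothPart_le_sum_rad (A : SieveSequence) (k : ℕ) {c : ℕ} (hck : c ≤ k) {x z ζ : ℝ}
    (hx : 1 ≤ x) :
    ∑ q ∈ (Nat.smoothNumbersUpTo ⌊x⌋₊ ⌈ζ⌉₊).filter (fun q : ℕ => q ≠ 1 ∧ Nat.minFac q < ⌈z⌉₊),
        generalizedVonMangoldt c q *
          ∑ n ∈ (Ioc 0 ⌊x⌋₊).filter (fun n : ℕ => smoothPart ⌈ζ⌉₊ n = q), A.a n ≤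
      ∑ ρ ∈ (primesProdBelow ζ).divisors.filter (fun ρ : ℕ => ρ ≠ 1 ∧ ρ.minFac < ⌈z⌉₊),
        (if ρ.primeFactors.card ≤ c then
            ((k : ℝ) * 2 ^ k + 1) ^ ρ.primeFactors.card * (∏ p ∈ ρ.primeFactors, Real.log p) *
              Real.log x ^ (c - ρ.primeFactors.card) else 0) *
          (A.restrictDvd ρ).sifted x (primesProdBelow ζ / ρ) := by
  set N := ⌊x⌋₊ with hN
  set B := ⌈ζ⌉₊ with hB
  set P := primesProdBelow ζ with hP
  set L := Real.log x with hL
  set Ck : ℝ := (k : ℝ) * 2 ^ k + 1 with hCk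
  set Qset := (Nat.smoothNumbersUpTo N B).filter (fun q : ℕ => q ≠ 1 ∧ Nat.minFac q < ⌈z⌉₊) with hQ
  set Rset := P.divisors.filter (fun ρ : ℕ => ρ ≠ 1 ∧ ρ.minFac < ⌈z⌉₊) with hR
  set W : ℕ → ℝ := fun ρ => if ρ.primeFactors.card ≤ c then
    Ck ^ ρ.primeFactors.card * (∏ p ∈ ρ.primeFactors, Real.log p) * L ^ (c - ρ.primeFactors.card)
    else 0 with hW
  set M : ℕ → ℝ := fun q => ∑ n ∈ (Ioc 0 N).filter (fun n : ℕ => smoothPart B n = q), A.a n with hM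
  have hx0 : 0 < x := by linarith
  have hL0 : 0 ≤ L := Real.log_nonneg hx
  have hPsf : Squarefree P := hP ▸ squarefree_primesProdBelow ζ
  have hP0 : P ≠ 0 := hPsf.ne_zero
  have hM0 : ∀ q, 0 ≤ M q := fun q => Finset.sum_nonneg fun n _ => A.a_nonneg n
  -- facts about `q ∈ Qset`
  have hQfacts : ∀ q ∈ Qset, q ≠ 0 ∧ (q : ℝ) ≤ x ∧ (∀ p ∈ q.primeFactors, p < B) ∧ q ≠ 1 ∧
      Nat.minFac q < ⌈z⌉₊ := by
    intro q hq
    rw [hQ, Finset.mem_filter, Nat.smoothNumbersUpTo, Finset.mem_filter, Finset.mem_range] at hq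
    obtain ⟨⟨hqN, hsm⟩, hq1, hmin⟩ := hq
    refine ⟨hsm.1, ?_, fun p hp => ?_, hq1, hmin⟩
    · exact le_trans (by exact_mod_cast Nat.lt_succ_iff.mp hqN) (Nat.floor_le hx0.le)
    · exact hsm.2 p (Nat.mem_primeFactors_iff_mem_primeFactorsList.mp hp)
  -- Step 2: `Λ_c(q) ≤ W(q)` (as a function of the prime factors of `q`)
  have hW_q : ∀ q ∈ Qset, generalizedVonMangoldt c q ≤ W q := by
    intro q hq
    obtain ⟨hq0, hqx, -, -, -⟩ := hQfacts q hq
    rw [hW]; simp only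
    split_ifs with hω
    · exact generalizedVonMangoldt_le_pow_prod_log k hx q hq0 hqx c hck hω
    · push Not at hω
      rw [generalizedVonMangoldt_eq_zero_of_lt_card_primeFactors hω]
  have hW0 : ∀ ρ, 0 ≤ W ρ := by
    intro ρ
    rw [hW]; simp only
    split_ifs
    · refine mul_nonneg (mul_nonneg (by positivity) (Finset.prod_nonneg fun p hp => ?_)) (by positivity)
      exact Real.log_nonneg (by exact_mod_cast (Nat.prime_of_mem_primeFactors hp).one_lt.le)
    · exact le_rfl
  -- Step 3: grouping by the radical
  have hmaps : ∀ q ∈ Qset, (∏ p ∈ q.primeFactors, p) ∈ Rset := by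
    intro q hq
    obtain ⟨hq0, -, hpB, hq1, hmin⟩ := hQfacts q hq
    have hsub : q.primeFactors ⊆ P.primeFactors := by
      intro p hp
      rw [hP, primeFactors_primesProdBelow, ← hB]
      exact Nat.mem_primesBelow.mpr ⟨hpB p hp, Nat.prime_of_mem_primeFactors hp⟩
    have hdvd : ∏ p ∈ q.primeFactors, p ∣ P := prod_dvd_of_subset_primeFactors hPsf hsub
    have hne : q.primeFactors.Nonempty := by
      rw [Finset.nonempty_iff_ne_empty, Ne, Nat.primeFactors_eq_empty]
      push Not
      exact ⟨hq0, hq1⟩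
    rw [hR, Finset.mem_filter]
    refine ⟨Nat.mem_divisors.mpr ⟨hdvd, hP0⟩, ?_, ?_⟩
    · intro h1
      have := Nat.primeFactors_prod (fun p hp => Nat.prime_of_mem_primeFactors (n := q) hp)
      rw [h1, Nat.primeFactors_one] at this
      exact hne.ne_empty this.symm
    · refine lt_of_le_of_lt (Nat.minFac_le_of_dvd (Nat.minFac_prime hq1).two_le ?_) hmin
      exact Finset.dvd_prod_of_mem _
        (Nat.mem_primeFactors.mpr ⟨Nat.minFac_prime hq1, Nat.minFac_dvd q, hq0⟩)
  -- `W` is constant on the fibers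
  have hWfiber : ∀ ρ ∈ Rset, ∀ q ∈ Qset.filter (fun q : ℕ => ∏ p ∈ q.primeFactors, p = ρ),
      W q = W ρ := by
    intro ρ _ q hq
    obtain ⟨-, hrad⟩ := Finset.mem_filter.mp hq
    have hpf : ρ.primeFactors = q.primeFactors := by
      rw [← hrad]
      exact Nat.primeFactors_prod fun p hp => Nat.prime_of_mem_primeFactors hp
    rw [hW]; simp only; rw [hpf]
  calc ∑ q ∈ Qset, generalizedVonMangoldt c q * M q
      ≤ ∑ q ∈ Qset, W q * M q :=
        Finset.sum_le_sum fun q hq => mul_le_mul_of_nonneg_right (hW_q q hq) (hM0 q)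
    _ = ∑ ρ ∈ Rset, ∑ q ∈ Qset.filter (fun q : ℕ => ∏ p ∈ q.primeFactors, p = ρ), W q * M q :=
        (Finset.sum_fiberwise_of_maps_to hmaps _).symm
    _ = ∑ ρ ∈ Rset, W ρ * ∑ q ∈ Qset.filter (fun q : ℕ => ∏ p ∈ q.primeFactors, p = ρ), M q := by
        refine Finset.sum_congr rfl fun ρ hρ => ?_
        rw [Finset.mul_sum]
        exact Finset.sum_congr rfl fun q hq => by rw [hWfiber ρ hρ q hq]
    _ ≤ ∑ ρ ∈ Rset, W ρ * (A.restrictDvd ρ).sifted x (P / ρ) := by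
        refine Finset.sum_le_sum fun ρ hρ => mul_le_mul_of_nonneg_left ?_ (hW0 ρ)
        have hρP : ρ ∣ P := Nat.dvd_of_mem_divisors (Finset.mem_filter.mp hρ).1
        have := sum_filter_rad_smoothPart_le A (x := x) (hP ▸ hρP) Qset
        rw [← hP, ← hB, ← hN] at this
        exact this

/-- **Step 4 of the `Σ₀`-bound**: the sieve (`sifted_restrictDvd_div_le`) inside the weighted sum
over the radicals `ρ` (weights `W_c(ρ) ≥ 0` vanishing unless `ω(ρ) ≤ c ≤ k`). [folklore] -/
theorem sum_rad_weight_sifted_le (A : SieveSequence) {K : ℝ} (hK : HasSieveDimension A.density 1 K)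
    (hsize : ∀ x, A.size x = x) (k : ℕ) {c : ℕ} (hck : c ≤ k) {x z ζ D Ck L : ℝ} (hx : 0 ≤ x)
    (hζ : 2 ≤ ζ) (hD1 : 1 < D) (hζD : 10 * Real.log ζ ≤ Real.log D) (hCk : 0 ≤ Ck) (hL : 0 ≤ L) :
    ∑ ρ ∈ (primesProdBelow ζ).divisors.filter (fun ρ : ℕ => ρ ≠ 1 ∧ ρ.minFac < ⌈z⌉₊),
        (if ρ.primeFactors.card ≤ c then
            Ck ^ ρ.primeFactors.card * (∏ p ∈ ρ.primeFactors, Real.log p) *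
              L ^ (c - ρ.primeFactors.card) else 0) *
          (A.restrictDvd ρ).sifted x (primesProdBelow ζ / ρ) ≤
      (1 + 2 * K ^ 10) * (2 * K) ^ k * x * A.densityProduct (primesProdBelow ζ) *
          ∑ ρ ∈ (primesProdBelow ζ).divisors.filter (fun ρ : ℕ => ρ ≠ 1 ∧ ρ.minFac < ⌈z⌉₊),
            (if ρ.primeFactors.card ≤ c then
              Ck ^ ρ.primeFactors.card * (∏ p ∈ ρ.primeFactors, Real.log p) *
                L ^ (c - ρ.primeFactors.card) else 0) * A.density ρ +
        ∑ ρ ∈ (primesProdBelow ζ).divisors.filter (fun ρ : ℕ => ρ ≠ 1 ∧ ρ.minFac < ⌈z⌉₊),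
          (if ρ.primeFactors.card ≤ c then
              Ck ^ ρ.primeFactors.card * (∏ p ∈ ρ.primeFactors, Real.log p) *
                L ^ (c - ρ.primeFactors.card) else 0) *
            ∑ d ∈ (primesProdBelow ζ / ρ).divisors.filter (fun d : ℕ => (d : ℝ) < D),
              |A.remainder (ρ * d) x| := by
  set P := primesProdBelow ζ with hP
  set Rset := P.divisors.filter (fun ρ : ℕ => ρ ≠ 1 ∧ ρ.minFac < ⌈z⌉₊) with hR
  set W : ℕ → ℝ := fun ρ => if ρ.primeFactors.card ≤ c then
    Ck ^ ρ.primeFactors.card * (∏ p ∈ ρ.primeFactors, Real.log p) * L ^ (c - ρ.primeFactors.card)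
    else 0 with hW
  set Cst : ℝ := (1 + 2 * K ^ 10) * (2 * K) ^ k with hCst
  set V := A.densityProduct P with hV
  have hK1 : 1 ≤ K := hK.one_le
  have hW0 : ∀ ρ, 0 ≤ W ρ := by
    intro ρ
    rw [hW]; simp only
    split_ifs
    · refine mul_nonneg (mul_nonneg (by positivity) (Finset.prod_nonneg fun p hp => ?_)) (by positivity)
      exact Real.log_nonneg (by exact_mod_cast (Nat.prime_of_mem_primeFactors hp).one_lt.le)
    · exact le_rfl
  have hterm : ∀ ρ ∈ Rset, W ρ * (A.restrictDvd ρ).sifted x (P / ρ) ≤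
      Cst * x * V * (W ρ * A.density ρ) +
        W ρ * ∑ d ∈ (P / ρ).divisors.filter (fun d : ℕ => (d : ℝ) < D), |A.remainder (ρ * d) x| := by
    intro ρ hρ
    have hρP : ρ ∣ P := Nat.dvd_of_mem_divisors (Finset.mem_filter.mp hρ).1
    by_cases hω : ρ.primeFactors.card ≤ c
    · have hs := sifted_restrictDvd_div_le A hK hsize hζ hD1 hζD hx (hP ▸ hρP) (hω.trans hck)
      rw [← hP] at hs
      calc W ρ * (A.restrictDvd ρ).sifted x (P / ρ)
          ≤ W ρ * ((1 + 2 * K ^ 10) * (2 * K) ^ k * A.density ρ * x * V +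
              ∑ d ∈ (P / ρ).divisors.filter (fun d : ℕ => (d : ℝ) < D), |A.remainder (ρ * d) x|) :=
            mul_le_mul_of_nonneg_left hs (hW0 ρ)
        _ = _ := by rw [hCst]; ring
    · have hWρ : W ρ = 0 := by rw [hW]; simp only; rw [if_neg hω]
      rw [hWρ]; simp
  refine (Finset.sum_le_sum hterm).trans (le_of_eq ?_)
  rw [Finset.sum_add_distrib, ← Finset.mul_sum]

/-- **Step 5 of the `Σ₀`-bound (the main terms)**: with `h(p) = g(p) log p`,
`∑_{ρ ∣ P(ζ), ρ≠1, minFac ρ<⌈z⌉} W_c(ρ) g(ρ) ≤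
 ∑_{w<c} C_k^{w+1} L^{c−(w+1)} (∑_{p<ζ, p<⌈z⌉} h(p)) (∑_{p<ζ} h(p))^w`
(`g(ρ) ∏ log p = ∏ h(p)` on squarefree `ρ`, then the peeling lemmata
`sum_divisors_card_succ_le`, `sum_divisors_card_eq_le_pow`). [folklore] -/
theorem sum_rad_weight_density_le (A : SieveSequence) {K : ℝ} (hK : HasSieveDimension A.density 1 K)
    (c : ℕ) {z ζ Ck L : ℝ} (hCk : 0 ≤ Ck) (hL : 0 ≤ L) :
    ∑ ρ ∈ (primesProdBelow ζ).divisors.filter (fun ρ : ℕ => ρ ≠ 1 ∧ ρ.minFac < ⌈z⌉₊),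
        (if ρ.primeFactors.card ≤ c then
            Ck ^ ρ.primeFactors.card * (∏ p ∈ ρ.primeFactors, Real.log p) *
              L ^ (c - ρ.primeFactors.card) else 0) * A.density ρ ≤
      ∑ w ∈ Finset.range c, Ck ^ (w + 1) * L ^ (c - (w + 1)) *
        ((∑ p ∈ (Nat.primesBelow ⌈ζ⌉₊).filter (· < ⌈z⌉₊), A.density p * Real.log p) *
          (∑ p ∈ Nat.primesBelow ⌈ζ⌉₊, A.density p * Real.log p) ^ w) := by
  set P := primesProdBelow ζ with hP
  set Rset := P.divisors.filter (fun ρ : ℕ => ρ ≠ 1 ∧ ρ.minFac < ⌈z⌉₊) with hR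
  set h : ℕ → ℝ := fun p => A.density p * Real.log p with hh
  have hPsf : Squarefree P := hP ▸ squarefree_primesProdBelow ζ
  have hP0 : P ≠ 0 := hPsf.ne_zero
  have hpfP : P.primeFactors = Nat.primesBelow ⌈ζ⌉₊ := by rw [hP, primeFactors_primesProdBelow]
  have hh0 : ∀ p ∈ P.primeFactors, 0 ≤ h p := fun p hp =>
    mul_nonneg (hK.1 p (Nat.prime_of_mem_primeFactors hp)).1
      (Real.log_nonneg (by exact_mod_cast (Nat.prime_of_mem_primeFactors hp).one_lt.le))
  have hprod0 : ∀ ρ ∈ P.divisors, 0 ≤ ∏ p ∈ ρ.primeFactors, h p := fun ρ hρ =>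
    Finset.prod_nonneg fun p hp => hh0 p (Nat.primeFactors_mono (Nat.dvd_of_mem_divisors hρ) hP0 hp)
  -- rewrite each term through `∏ h(p)` and split according to `w + 1 = ω(ρ) ∈ [1, c]`
  have hterm : ∀ ρ ∈ Rset,
      (if ρ.primeFactors.card ≤ c then
          Ck ^ ρ.primeFactors.card * (∏ p ∈ ρ.primeFactors, Real.log p) *
            L ^ (c - ρ.primeFactors.card) else 0) * A.density ρ =
        ∑ w ∈ Finset.range c, if ρ.primeFactors.card = w + 1 then
          Ck ^ (w + 1) * L ^ (c - (w + 1)) * ∏ p ∈ ρ.primeFactors, h p else 0 := by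
    intro ρ hρ
    obtain ⟨hρ', hρ1, -⟩ := Finset.mem_filter.mp hρ
    have hρP : ρ ∣ P := Nat.dvd_of_mem_divisors hρ'
    have hρsf : Squarefree ρ := hPsf.squarefree_of_dvd hρP
    have hρ0 : ρ ≠ 0 := hρsf.ne_zero
    have hprodh : ∏ p ∈ ρ.primeFactors, h p =
        (∏ p ∈ ρ.primeFactors, Real.log p) * A.density ρ := by
      rw [BetaSieve.map_eq_prod_primeFactors A.density_mult hρsf, ← Finset.prod_mul_distrib]
      exact Finset.prod_congr rfl fun p _ => by rw [hh]; simp only; ring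
    set wρ := ρ.primeFactors.card with hwρ
    have hw1 : 1 ≤ wρ := by
      rw [hwρ, Nat.one_le_iff_ne_zero, Ne, Finset.card_eq_zero, Nat.primeFactors_eq_empty]
      push Not; exact ⟨hρ0, hρ1⟩
    by_cases hwc : wρ ≤ c
    · rw [if_pos hwc, Finset.sum_eq_single (wρ - 1)]
      · rw [if_pos (by omega), Nat.sub_add_cancel hw1, hprodh]; ring
      · intro w _ hw
        rw [if_neg (by omega)]
      · intro hnot
        exfalso; exact hnot (Finset.mem_range.mpr (by omega))
    · rw [if_neg hwc, zero_mul]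
      refine (Finset.sum_eq_zero fun w hw => ?_).symm
      rw [if_neg]
      have := Finset.mem_range.mp hw
      omega
  rw [Finset.sum_congr rfl hterm, Finset.sum_comm]
  refine Finset.sum_le_sum fun w _ => ?_
  rw [← Finset.sum_filter, ← Finset.mul_sum]
  refine mul_le_mul_of_nonneg_left ?_ (by positivity)
  -- peeling
  have hsub : Rset.filter (fun ρ : ℕ => ρ.primeFactors.card = w + 1) ⊆
      P.divisors.filter (fun ρ : ℕ => ρ.primeFactors.card = w + 1 ∧ ρ.minFac < ⌈z⌉₊) := by
    intro ρ hρ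
    rw [Finset.mem_filter, hR, Finset.mem_filter] at hρ
    rw [Finset.mem_filter]
    exact ⟨hρ.1.1, hρ.2, hρ.1.2.2⟩
  calc ∑ ρ ∈ Rset.filter (fun ρ : ℕ => ρ.primeFactors.card = w + 1), ∏ p ∈ ρ.primeFactors, h p
      ≤ ∑ ρ ∈ P.divisors.filter (fun ρ : ℕ => ρ.primeFactors.card = w + 1 ∧ ρ.minFac < ⌈z⌉₊),
          ∏ p ∈ ρ.primeFactors, h p :=
        Finset.sum_le_sum_of_subset_of_nonneg hsub fun ρ hρ _ => hprod0 ρ (Finset.mem_filter.mp hρ).1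
    _ ≤ (∑ p ∈ P.primeFactors.filter (· < ⌈z⌉₊), h p) *
          ∑ ρ ∈ P.divisors.filter (fun ρ : ℕ => ρ.primeFactors.card = w), ∏ p ∈ ρ.primeFactors, h p :=
        sum_divisors_card_succ_le hPsf h hh0 ⌈z⌉₊ w
    _ ≤ (∑ p ∈ P.primeFactors.filter (· < ⌈z⌉₊), h p) * (∑ p ∈ P.primeFactors, h p) ^ w :=
        mul_le_mul_of_nonneg_left (sum_divisors_card_eq_le_pow hPsf h hh0 w)
          (Finset.sum_nonneg fun p hp => hh0 p (Finset.mem_filter.mp hp).1)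
    _ = _ := by rw [hpfP]

/-- **Step 6 of the `Σ₀`-bound (the remainders)**: since `W_c(ρ) ≤ C_k^k L^c` (`log p ≤ L` for
`p ∣ P(ζ)`, `C_k ≥ 1`), the weighted remainder sum is at most `C_k^k L^c` times
`∑_{ρ ∣ P(ζ), ω(ρ) ≤ k} ∑_{d ∣ P(ζ)/ρ, d < D} |R_{ρd}(x)|`, which `sum_divisors_sum_le_mul` bounds by
`(log₂ X + 1)^k ∑_{m ∈ T} |R_m(x)|` once all `ρ d ∈ T ⊆ [1, X]`. [folklore] -/
theorem sum_rad_weight_remainder_le (A : SieveSequence) (k : ℕ) {c : ℕ} (hck : c ≤ k)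
    {x z ζ D Ck L : ℝ} (hCk : 1 ≤ Ck) (hL : 0 ≤ L)
    (hlog : ∀ p ∈ (primesProdBelow ζ).primeFactors, Real.log p ≤ L) (T : Finset ℕ)
    (hT : ∀ ρ ∈ (primesProdBelow ζ).divisors.filter (fun ρ : ℕ => ρ.primeFactors.card ≤ k),
      ∀ d ∈ (primesProdBelow ζ / ρ).divisors.filter (fun d : ℕ => (d : ℝ) < D), ρ * d ∈ T)
    (X : ℕ) (hX : ∀ m ∈ T, m ≤ X) :
    ∑ ρ ∈ (primesProdBelow ζ).divisors.filter (fun ρ : ℕ => ρ ≠ 1 ∧ ρ.minFac < ⌈z⌉₊),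
        (if ρ.primeFactors.card ≤ c then
            Ck ^ ρ.primeFactors.card * (∏ p ∈ ρ.primeFactors, Real.log p) *
              L ^ (c - ρ.primeFactors.card) else 0) *
          ∑ d ∈ (primesProdBelow ζ / ρ).divisors.filter (fun d : ℕ => (d : ℝ) < D),
            |A.remainder (ρ * d) x| ≤
      Ck ^ k * L ^ c * ((((Nat.log 2 X + 1) ^ k : ℕ) : ℝ) *
        ∑ m ∈ T, |A.remainder m x|) := by
  set P := primesProdBelow ζ with hP
  set Rset := P.divisors.filter (fun ρ : ℕ => ρ ≠ 1 ∧ ρ.minFac < ⌈z⌉₊) with hR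
  set Dv : ℕ → Finset ℕ := fun ρ => (P / ρ).divisors.filter (fun d : ℕ => (d : ℝ) < D) with hDv
  set Rs : ℕ → ℝ := fun ρ => ∑ d ∈ Dv ρ, |A.remainder (ρ * d) x| with hRs
  have hPsf : Squarefree P := hP ▸ squarefree_primesProdBelow ζ
  have hP0 : P ≠ 0 := hPsf.ne_zero
  have hRs0 : ∀ ρ, 0 ≤ Rs ρ := fun ρ => Finset.sum_nonneg fun d _ => abs_nonneg _
  -- `W(ρ) ≤ Ck^k L^c [ω(ρ) ≤ k]`
  have hWle : ∀ ρ ∈ Rset,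
      (if ρ.primeFactors.card ≤ c then
          Ck ^ ρ.primeFactors.card * (∏ p ∈ ρ.primeFactors, Real.log p) *
            L ^ (c - ρ.primeFactors.card) else 0) * Rs ρ ≤
        if ρ.primeFactors.card ≤ k then Ck ^ k * L ^ c * Rs ρ else 0 := by
    intro ρ hρ
    have hρP : ρ ∣ P := Nat.dvd_of_mem_divisors (Finset.mem_filter.mp hρ).1
    split_ifs with h1 h2
    · refine mul_le_mul_of_nonneg_right ?_ (hRs0 ρ)
      have hprod : ∏ p ∈ ρ.primeFactors, Real.log p ≤ L ^ ρ.primeFactors.card := by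
        rw [← Finset.prod_const]
        refine Finset.prod_le_prod (fun p hp => Real.log_nonneg ?_) fun p hp =>
          hlog p (Nat.primeFactors_mono hρP hP0 hp)
        exact_mod_cast (Nat.prime_of_mem_primeFactors hp).one_lt.le
      have hP0' : 0 ≤ ∏ p ∈ ρ.primeFactors, Real.log p := Finset.prod_nonneg fun p hp =>
        Real.log_nonneg (by exact_mod_cast (Nat.prime_of_mem_primeFactors hp).one_lt.le)
      calc Ck ^ ρ.primeFactors.card * (∏ p ∈ ρ.primeFactors, Real.log p) *
            L ^ (c - ρ.primeFactors.card)
          ≤ Ck ^ k * L ^ ρ.primeFactors.card * L ^ (c - ρ.primeFactors.card) :=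
            mul_le_mul_of_nonneg_right (mul_le_mul (pow_le_pow_right₀ hCk h2) hprod hP0'
              (by positivity)) (by positivity)
        _ = Ck ^ k * L ^ c := by
            rw [mul_assoc, ← pow_add, Nat.add_sub_cancel' h1]
    · exact absurd (h1.trans hck) h2
    · rw [zero_mul]; exact mul_nonneg (by positivity) (hRs0 ρ)
    · rw [zero_mul]
  have hRsub : Rset ⊆ P.divisors := Finset.filter_subset _ _
  calc ∑ ρ ∈ Rset, (if ρ.primeFactors.card ≤ c then
          Ck ^ ρ.primeFactors.card * (∏ p ∈ ρ.primeFactors, Real.log p) *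
            L ^ (c - ρ.primeFactors.card) else 0) * Rs ρ
      ≤ ∑ ρ ∈ Rset, (if ρ.primeFactors.card ≤ k then Ck ^ k * L ^ c * Rs ρ else 0) :=
        Finset.sum_le_sum hWle
    _ ≤ ∑ ρ ∈ P.divisors, (if ρ.primeFactors.card ≤ k then Ck ^ k * L ^ c * Rs ρ else 0) :=
        Finset.sum_le_sum_of_subset_of_nonneg hRsub fun ρ _ _ => by
          split_ifs
          · exact mul_nonneg (by positivity) (hRs0 ρ)
          · exact le_rfl
    _ = Ck ^ k * L ^ c * ∑ ρ ∈ P.divisors.filter (fun ρ : ℕ => ρ.primeFactors.card ≤ k), Rs ρ := by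
        rw [← Finset.sum_filter, Finset.mul_sum]
    _ ≤ Ck ^ k * L ^ c * ((((Nat.log 2 X + 1) ^ k : ℕ) : ℝ) * ∑ m ∈ T, |A.remainder m x|) := by
        refine mul_le_mul_of_nonneg_left ?_ (by positivity)
        refine sum_divisors_sum_le_mul hPsf k (fun m => |A.remainder m x|) (fun m => abs_nonneg _)
          Dv (fun ρ hρ d hd => ?_) T hT X hX
        exact Nat.dvd_of_mem_divisors (Finset.mem_filter.mp hd).1

/-! ### `Σ₀` at a fixed height -/

/-- **The `Σ₀`-bound at a fixed height, all inputs explicit.** For `k = m + 2`, `x ≥ 1`,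
`2 ≤ z ≤ ζ ≤ x`, `2 ≤ ζ`, `1 < D`, `10 log ζ ≤ log D`, with `V(ζ) ≤ V₀`,
`∑_{p<ζ,p<⌈z⌉} g(p) log p ≤ T_z`, `∑_{p<ζ} g(p) log p ≤ T_ζ`, all moduli `ρ d` (`ρ ∣ P(ζ)`,
`ω(ρ) ≤ k`, `d ∣ P(ζ)/ρ`, `d < D`) in `T ⊆ [1, X]` and `∑_{m ∈ T} |R_m(x)| ≤ R_T`:
`Σ₀ ≤ ∑_{c ≤ k} ∑_{w < c} C(k,c) L^{k−c} (C_st x V₀) (C_k^{w+1} L^{c−w−1} T_z T_ζ^w)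
      + ∑_{c ≤ k} C(k,c) L^{k−c} C_k^k L^c (log₂ X + 1)^k R_T`
(`C_st = (1+2K^{10})(2K)^k`, `C_k = k 2^k + 1`). Chain: `sigma0_le_sum_smoothPart`,
`sum_smoothPart_le_sum_rad`, `sum_rad_weight_sifted_le`, `sum_rad_weight_density_le`,
`sum_rad_weight_remainder_le`. [cite: FriedlanderIwaniecPisa1978, Lemma 10] -/
theorem sigma0_bound_at (A : SieveSequence) {K : ℝ} (hK : HasSieveDimension A.density 1 K)
    (hsize : ∀ x, A.size x = x) (m : ℕ) {x z ζ D V₀ Tz Tζ RT : ℝ} (hx : 1 ≤ x) (hz : 2 ≤ z)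
    (hzζ : z ≤ ζ) (hζ : 2 ≤ ζ) (hζx : ζ ≤ x) (hD1 : 1 < D) (hζD : 10 * Real.log ζ ≤ Real.log D)
    (hV : A.densityProduct (primesProdBelow ζ) ≤ V₀)
    (hTz : ∑ p ∈ (Nat.primesBelow ⌈ζ⌉₊).filter (· < ⌈z⌉₊), A.density p * Real.log p ≤ Tz)
    (hTζ : ∑ p ∈ Nat.primesBelow ⌈ζ⌉₊, A.density p * Real.log p ≤ Tζ)
    (T : Finset ℕ) (X : ℕ) (hX : ∀ n ∈ T, n ≤ X)
    (hT : ∀ ρ ∈ (primesProdBelow ζ).divisors.filter (fun ρ : ℕ => ρ.primeFactors.card ≤ m + 2),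
      ∀ d ∈ (primesProdBelow ζ / ρ).divisors.filter (fun d : ℕ => (d : ℝ) < D), ρ * d ∈ T)
    (hRT : ∑ n ∈ T, |A.remainder n x| ≤ RT) :
    sigma0 A (m + 2) x z ≤
      ∑ c ∈ Finset.range (m + 3), ∑ w ∈ Finset.range c,
          ((m + 2).choose c : ℝ) * Real.log x ^ (m + 2 - c) *
            ((1 + 2 * K ^ 10) * (2 * K) ^ (m + 2) * x * V₀) *
            ((((m + 2 : ℕ) : ℝ) * 2 ^ (m + 2) + 1) ^ (w + 1) * Real.log x ^ (c - (w + 1)) *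
              (Tz * Tζ ^ w)) +
        ∑ c ∈ Finset.range (m + 3), ((m + 2).choose c : ℝ) * Real.log x ^ (m + 2 - c) *
          ((((m + 2 : ℕ) : ℝ) * 2 ^ (m + 2) + 1) ^ (m + 2) * Real.log x ^ c *
            ((((Nat.log 2 X + 1) ^ (m + 2) : ℕ) : ℝ) * RT)) := by
  set P := primesProdBelow ζ with hP
  set L := Real.log x with hL
  set Ck : ℝ := ((m + 2 : ℕ) : ℝ) * 2 ^ (m + 2) + 1 with hCk
  set Cst : ℝ := (1 + 2 * K ^ 10) * (2 * K) ^ (m + 2) with hCst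
  set V := A.densityProduct P with hVdef
  have hK1 : 1 ≤ K := hK.one_le
  have hx0 : 0 < x := by linarith
  have hL0 : 0 ≤ L := Real.log_nonneg hx
  have hCk1 : 1 ≤ Ck := by rw [hCk]; exact le_add_of_nonneg_left (by positivity)
  have hzB : ⌈z⌉₊ ≤ ⌈ζ⌉₊ := Nat.ceil_le_ceil hzζ
  have hPsf : Squarefree P := hP ▸ squarefree_primesProdBelow ζ
  have hP0 : P ≠ 0 := hPsf.ne_zero
  have hg0 : ∀ p : ℕ, p.Prime → 0 ≤ A.density p := fun p hp => (hK.1 p hp).1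
  have hV0 : 0 ≤ V := by
    rw [hVdef, hP, densityProduct_primesProdBelow]
    exact Finset.prod_nonneg fun p hp =>
      (sub_pos.mpr (hK.1 p (Nat.prime_of_mem_primesBelow hp)).2).le
  have hTz0 : 0 ≤ ∑ p ∈ (Nat.primesBelow ⌈ζ⌉₊).filter (· < ⌈z⌉₊), A.density p * Real.log p :=
    Finset.sum_nonneg fun p hp => mul_nonneg (hg0 p (Nat.prime_of_mem_primesBelow
      (Finset.mem_filter.mp hp).1)) (Real.log_nonneg (by
        exact_mod_cast (Nat.prime_of_mem_primesBelow (Finset.mem_filter.mp hp).1).one_lt.le))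
  have hTζ0 : 0 ≤ ∑ p ∈ Nat.primesBelow ⌈ζ⌉₊, A.density p * Real.log p :=
    Finset.sum_nonneg fun p hp => mul_nonneg (hg0 p (Nat.prime_of_mem_primesBelow hp))
      (Real.log_nonneg (by exact_mod_cast (Nat.prime_of_mem_primesBelow hp).one_lt.le))
  have hlogp : ∀ p ∈ P.primeFactors, Real.log p ≤ L := by
    intro p hp
    have hpp := Nat.prime_of_mem_primeFactors hp
    have hpζ : (p : ℝ) < ζ := (dvd_primesProdBelow_iff hpp ζ).mp (hP ▸ Nat.dvd_of_mem_primeFactors hp)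
    exact Real.log_le_log (by exact_mod_cast hpp.pos) (by linarith)
  -- Step 1
  have h1 := sigma0_le_sum_smoothPart A (m + 2) (B := ⌈ζ⌉₊) hx hzB
  refine h1.trans ?_
  rw [← Finset.sum_add_distrib]
  refine Finset.sum_le_sum fun c hc => ?_
  have hck : c ≤ m + 2 := Nat.lt_succ_iff.mp (Finset.mem_range.mp hc)
  have hcoef0 : 0 ≤ ((m + 2).choose c : ℝ) * L ^ (m + 2 - c) := by positivity
  -- the inner sum for this `c`
  have hW0 : ∀ ρ ∈ P.divisors.filter (fun ρ : ℕ => ρ ≠ 1 ∧ ρ.minFac < ⌈z⌉₊),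
      0 ≤ (if ρ.primeFactors.card ≤ c then
          Ck ^ ρ.primeFactors.card * (∏ p ∈ ρ.primeFactors, Real.log p) *
            L ^ (c - ρ.primeFactors.card) else 0) * A.density ρ := by
    intro ρ hρ
    refine mul_nonneg ?_ ?_
    · split_ifs
      · refine mul_nonneg (mul_nonneg (by positivity) (Finset.prod_nonneg fun p hp => ?_))
          (by positivity)
        exact Real.log_nonneg (by exact_mod_cast (Nat.prime_of_mem_primeFactors hp).one_lt.le)
      · exact le_rfl
    · have hρsf : Squarefree ρ := hPsf.squarefree_of_dvd
        (Nat.dvd_of_mem_divisors (Finset.mem_filter.mp hρ).1)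
      rw [BetaSieve.map_eq_prod_primeFactors A.density_mult hρsf]
      exact Finset.prod_nonneg fun p hp => hg0 p (Nat.prime_of_mem_primeFactors hp)
  have key : ∑ q ∈ (Nat.smoothNumbersUpTo ⌊x⌋₊ ⌈ζ⌉₊).filter
        (fun q : ℕ => q ≠ 1 ∧ Nat.minFac q < ⌈z⌉₊),
        generalizedVonMangoldt c q *
          ∑ n ∈ (Ioc 0 ⌊x⌋₊).filter (fun n : ℕ => smoothPart ⌈ζ⌉₊ n = q), A.a n ≤
      Cst * x * V₀ * ∑ w ∈ Finset.range c, Ck ^ (w + 1) * L ^ (c - (w + 1)) * (Tz * Tζ ^ w) +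
        Ck ^ (m + 2) * L ^ c * ((((Nat.log 2 X + 1) ^ (m + 2) : ℕ) : ℝ) * RT) := by
    -- Steps 2–3
    refine (sum_smoothPart_le_sum_rad A (m + 2) hck (z := z) (ζ := ζ) hx).trans ?_
    rw [← hP, ← hL, ← hCk]
    -- Step 4
    refine (sum_rad_weight_sifted_le A hK hsize (m + 2) hck (z := z) hx0.le hζ hD1 hζD
      (by linarith : (0 : ℝ) ≤ Ck) hL0).trans ?_
    rw [← hP, ← hCst, ← hVdef]
    refine add_le_add ?_ ?_
    · -- Step 5 (main terms)
      have h5 := sum_rad_weight_density_le A hK c (z := z) (ζ := ζ) (by linarith : (0 : ℝ) ≤ Ck) hL0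
      rw [← hP] at h5
      calc Cst * x * V * _ ≤ Cst * x * V₀ * ∑ w ∈ Finset.range c, Ck ^ (w + 1) * L ^ (c - (w + 1)) *
            ((∑ p ∈ (Nat.primesBelow ⌈ζ⌉₊).filter (· < ⌈z⌉₊), A.density p * Real.log p) *
              (∑ p ∈ Nat.primesBelow ⌈ζ⌉₊, A.density p * Real.log p) ^ w) :=
            mul_le_mul (mul_le_mul_of_nonneg_left hV (by positivity)) h5
              (Finset.sum_nonneg hW0) (mul_nonneg (by positivity) (hV0.trans hV))
        _ ≤ Cst * x * V₀ * ∑ w ∈ Finset.range c, Ck ^ (w + 1) * L ^ (c - (w + 1)) * (Tz * Tζ ^ w) := by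
            refine mul_le_mul_of_nonneg_left (Finset.sum_le_sum fun w _ =>
              mul_le_mul_of_nonneg_left ?_ (by positivity)) ?_
            · exact mul_le_mul hTz (pow_le_pow_left₀ hTζ0 hTζ w) (pow_nonneg hTζ0 w) (hTz0.trans hTz)
            · exact mul_nonneg (by positivity) (hV0.trans hV)
    · -- Step 6 (remainders)
      have h6 := sum_rad_weight_remainder_le A (m + 2) hck (x := x) (z := z) (ζ := ζ) (D := D) hCk1
        hL0 hlogp T hT X hX
      rw [← hP] at h6
      refine h6.trans (mul_le_mul_of_nonneg_left (mul_le_mul_of_nonneg_left hRT (by positivity)) ?_)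
      positivity
  calc ((m + 2).choose c : ℝ) * Real.log x ^ (m + 2 - c) * _
      ≤ ((m + 2).choose c : ℝ) * L ^ (m + 2 - c) *
          (Cst * x * V₀ * ∑ w ∈ Finset.range c, Ck ^ (w + 1) * L ^ (c - (w + 1)) * (Tz * Tζ ^ w) +
            Ck ^ (m + 2) * L ^ c * ((((Nat.log 2 X + 1) ^ (m + 2) : ℕ) : ℝ) * RT)) :=
        mul_le_mul_of_nonneg_left key hcoef0
    _ = _ := by
        rw [mul_add, Finset.mul_sum, Finset.mul_sum]
        congr 1
        exact Finset.sum_congr rfl fun w _ => by ring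

/-! ### The arithmetic of the two sums -/

/-- One main term: `C(k,c) L^{k−c} (C_st x C_V/(θ₀ L)) (C_k^{w+1} L^{c−w−1} (C₁ log z)(C₁ θ₀ L)^w)
≤ U x L^m log z` with `U = 2^k C_st C_V C_k^k C₁ max(1, C₁θ₀)^k/θ₀` (`k = m+2`, `w + 1 ≤ c ≤ k`).
[folklore] -/
theorem numMain {Cst CV C₁ Ck θ₀ L lz x : ℝ} (m : ℕ) {c w : ℕ} (hc : c ≤ m + 2) (hw : w + 1 ≤ c)
    (hCst : 0 ≤ Cst) (hCV : 0 ≤ CV) (hC₁ : 0 ≤ C₁) (hCk : 1 ≤ Ck) (hθ : 0 < θ₀) (hL : 0 < L)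
    (hlz : 0 ≤ lz) (hx : 0 ≤ x) :
    ((m + 2).choose c : ℝ) * L ^ (m + 2 - c) * (Cst * x * (CV / (θ₀ * L))) *
        (Ck ^ (w + 1) * L ^ (c - (w + 1)) * ((C₁ * lz) * (C₁ * (θ₀ * L)) ^ w)) ≤
      (2 ^ (m + 2) * Cst * CV * Ck ^ (m + 2) * C₁ * (max 1 (C₁ * θ₀)) ^ (m + 2) / θ₀) *
        x * L ^ m * lz := by
  set M := max 1 (C₁ * θ₀) with hM
  have hM1 : 1 ≤ M := le_max_left _ _
  have hchoose : ((m + 2).choose c : ℝ) ≤ 2 ^ (m + 2) := by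
    have h := Nat.choose_le_two_pow (m + 2) c
    exact_mod_cast h
  have hCkpow : Ck ^ (w + 1) ≤ Ck ^ (m + 2) := pow_le_pow_right₀ hCk (by omega)
  have hMpow : (C₁ * θ₀) ^ w ≤ M ^ (m + 2) :=
    calc (C₁ * θ₀) ^ w ≤ M ^ w := pow_le_pow_left₀ (by positivity) (le_max_right _ _) w
      _ ≤ M ^ (m + 2) := pow_le_pow_right₀ hM1 (by omega)
  have hLid : L ^ (m + 2 - c) * L ^ (c - (w + 1)) * L ^ w = L ^ m * L := by
    rw [← pow_add, ← pow_add, ← pow_succ]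
    congr 1; omega
  have hsplit : (C₁ * (θ₀ * L)) ^ w = (C₁ * θ₀) ^ w * L ^ w := by rw [← mul_pow]; ring
  rw [hsplit]
  have heq : ((m + 2).choose c : ℝ) * L ^ (m + 2 - c) * (Cst * x * (CV / (θ₀ * L))) *
      (Ck ^ (w + 1) * L ^ (c - (w + 1)) * ((C₁ * lz) * ((C₁ * θ₀) ^ w * L ^ w))) =
      (((m + 2).choose c : ℝ) * Ck ^ (w + 1) * (C₁ * θ₀) ^ w) * (Cst * CV * C₁ / θ₀ * x * lz) *
        ((L ^ (m + 2 - c) * L ^ (c - (w + 1)) * L ^ w) / L) := by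
    field_simp
  rw [heq, hLid, mul_div_cancel_right₀ _ hL.ne']
  have hA : ((m + 2).choose c : ℝ) * Ck ^ (w + 1) * (C₁ * θ₀) ^ w ≤
      2 ^ (m + 2) * Ck ^ (m + 2) * M ^ (m + 2) :=
    mul_le_mul (mul_le_mul hchoose hCkpow (by positivity) (by positivity)) hMpow (by positivity)
      (by positivity)
  calc (((m + 2).choose c : ℝ) * Ck ^ (w + 1) * (C₁ * θ₀) ^ w) * (Cst * CV * C₁ / θ₀ * x * lz) * L ^ m
      ≤ (2 ^ (m + 2) * Ck ^ (m + 2) * M ^ (m + 2)) * (Cst * CV * C₁ / θ₀ * x * lz) * L ^ m :=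
        mul_le_mul_of_nonneg_right (mul_le_mul_of_nonneg_right hA (by positivity)) (by positivity)
    _ = _ := by ring

/-- One remainder term: `C(k,c) L^{k−c} C_k^k L^c (log₂ X + 1)^k R_T ≤ (δ/(k+1)) x L^{m+1}` once
`(log₂ X + 1)^k ≤ (4L)^k`, `R_T = C_R x/L^{2k+2}` and `(k+1) 2^k C_k^k 4^k C_R ≤ δ L^{k+1}`. [folklore] -/
theorem numRem {Ck CR δ L x Fib : ℝ} (m : ℕ) {c : ℕ} (hc : c ≤ m + 2) (hCk : 1 ≤ Ck) (hCR : 0 ≤ CR)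
    (hδ : 0 < δ) (hL : 1 ≤ L) (hx : 0 ≤ x) (hFib0 : 0 ≤ Fib) (hFib : Fib ≤ (4 * L) ^ (m + 2))
    (hev : ((m : ℝ) + 3) * 2 ^ (m + 2) * Ck ^ (m + 2) * 4 ^ (m + 2) * CR ≤ δ * L ^ (m + 3)) :
    ((m + 2).choose c : ℝ) * L ^ (m + 2 - c) *
        (Ck ^ (m + 2) * L ^ c * (Fib * (CR * x / L ^ (2 * (m + 2) + 2)))) ≤
      δ / ((m : ℝ) + 3) * x * L ^ (m + 1) := by
  have hL0 : 0 < L := by linarith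
  have hchoose : ((m + 2).choose c : ℝ) ≤ 2 ^ (m + 2) := by
    have h := Nat.choose_le_two_pow (m + 2) c
    exact_mod_cast h
  have hLid : L ^ (m + 2 - c) * L ^ c = L ^ (m + 2) := by rw [← pow_add]; congr 1; omega
  have heq : ((m + 2).choose c : ℝ) * L ^ (m + 2 - c) *
      (Ck ^ (m + 2) * L ^ c * (Fib * (CR * x / L ^ (2 * (m + 2) + 2)))) =
      (((m + 2).choose c : ℝ) * Fib) * (Ck ^ (m + 2) * CR * x) *
        ((L ^ (m + 2 - c) * L ^ c) / L ^ (2 * (m + 2) + 2)) := by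
    field_simp
  rw [heq, hLid]
  have hL2 : L ^ (m + 2) / L ^ (2 * (m + 2) + 2) = (L ^ (m + 2) * L ^ 2)⁻¹ := by
    rw [show 2 * (m + 2) + 2 = (m + 2) + ((m + 2) + 2) by ring, pow_add, pow_add]
    field_simp
    ring
  rw [hL2]
  have hA : ((m + 2).choose c : ℝ) * Fib ≤ 2 ^ (m + 2) * (4 ^ (m + 2) * L ^ (m + 2)) := by
    calc ((m + 2).choose c : ℝ) * Fib ≤ 2 ^ (m + 2) * (4 * L) ^ (m + 2) :=
          mul_le_mul hchoose hFib hFib0 (by positivity)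
      _ = 2 ^ (m + 2) * (4 ^ (m + 2) * L ^ (m + 2)) := by rw [mul_pow]
  have hk3 : (0 : ℝ) < (m : ℝ) + 3 := by positivity
  calc (((m + 2).choose c : ℝ) * Fib) * (Ck ^ (m + 2) * CR * x) * (L ^ (m + 2) * L ^ 2)⁻¹
      ≤ (2 ^ (m + 2) * (4 ^ (m + 2) * L ^ (m + 2))) * (Ck ^ (m + 2) * CR * x) * (L ^ (m + 2) * L ^ 2)⁻¹ :=
        mul_le_mul_of_nonneg_right (mul_le_mul_of_nonneg_right hA (by positivity)) (by positivity)
    _ = (2 ^ (m + 2) * Ck ^ (m + 2) * 4 ^ (m + 2) * CR) * x / L ^ 2 := by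
        field_simp
    _ ≤ (δ * L ^ (m + 3) / ((m : ℝ) + 3)) * x / L ^ 2 := by
        refine div_le_div_of_nonneg_right (mul_le_mul_of_nonneg_right ?_ hx) (by positivity)
        rw [le_div_iff₀ hk3]
        linarith
    _ = δ / ((m : ℝ) + 3) * x * L ^ (m + 1) := by
        field_simp
        ring

/-! ### [FriedlanderIwaniecPisa1978] Lemma 10 under the tree hypotheses -/

/-- A squarefree `ρ` all of whose prime factors are `< ζ` satisfies `ρ ≤ ζ^{ω(ρ)}`.
[folklore] -/
theorem cast_le_pow_card_primeFactors {ρ : ℕ} (hρ : Squarefree ρ) {ζ : ℝ}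
    (h : ∀ p ∈ ρ.primeFactors, (p : ℝ) < ζ) : (ρ : ℝ) ≤ ζ ^ ρ.primeFactors.card := by
  calc (ρ : ℝ) = ((∏ p ∈ ρ.primeFactors, p : ℕ) : ℝ) := by
        rw [Nat.prod_primeFactors_of_squarefree hρ]
    _ = ∏ p ∈ ρ.primeFactors, (p : ℝ) := by push_cast; rfl
    _ ≤ ∏ _p ∈ ρ.primeFactors, ζ :=
        Finset.prod_le_prod (fun p _ => Nat.cast_nonneg p) fun p hp => (h p hp).le
    _ = ζ ^ ρ.primeFactors.card := Finset.prod_const _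

/-- The primes `< ⌈ζ⌉₊` are among the primes `≤ ⌊ζ⌋₊`. [folklore] -/
theorem primesBelow_ceil_subset_primesLE_floor (ζ : ℝ) :
    Nat.primesBelow ⌈ζ⌉₊ ⊆ Nat.primesLE ⌊ζ⌋₊ := by
  intro p hp
  rw [Nat.mem_primesBelow] at hp
  exact Nat.mem_primesLE.mpr ⟨Nat.le_floor (Nat.lt_ceil.mp hp.1).le, hp.2⟩

/-- **[FriedlanderIwaniecPisa1978] Lemma 10 (the `Σ₀`-estimate) under the hypotheses of
`Literature.NumberTheory.Sieve.bombieri_asymptotic_sieve`** (size `X(x) = x`, `HasSieveDimension g 1 K`,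
`HasLinearDensity c`, `HasDensityConstant H`, level of distribution `x^θ` for every `θ < 1` on
squarefree moduli), in the small range and in the shape consumed by the assembly of the theorem:
with `θ₀ = 1/(2(k+10))` there is `C` such that for every `δ > 0`, all large `x` and all
`2 ≤ z ≤ x^{θ₀}`, `Σ₀ ≤ C x (log x)^{k−2} log z + δ x (log x)^{k−1}`.
Proof: `sigma0_bound_at` at `ζ = x^{θ₀}`, `D = ζ^{10}` (all moduli `ρ d < ζ^{k+10} = x^{1/2}`,
squarefree), fed with `V(ζ) ≪ 1/log ζ` (`exists_densityProduct_le`), `∑_{p ≤ X} g(p) log p ≪ log X`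
(`exists_sum_density_log_le`) and the level of distribution at level `x^{1/2}` with saving
`(log x)^{2k+2}` (`level_bound`); the arithmetic is `numMain`, `numRem`. (Bombieri's own proof of
the `Σ₀`-bound — his Lemmata 1, 2 — and the uniform version [FriedlanderIwaniecPisa1978] Lemma 24
are organised differently; the statement proved is the one used on p. 739.)
[cite: FriedlanderIwaniecPisa1978, Lemma 10] -/
theorem treeLemma10 (k : ℕ) (hk : 2 ≤ k) (A : SieveSequence) (H c : ℝ)
    (hsize : ∀ x, A.size x = x) (hdim : ∃ K : ℝ, HasSieveDimension A.density 1 K)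
    (hlin : A.HasLinearDensity c) (hH : A.HasDensityConstant H)
    (hlevel : ∀ θ : ℝ, θ < 1 → HasLevelOfDistribution A θ) :
    ∃ θ₀ : ℝ, 0 < θ₀ ∧ ∃ C : ℝ, ∀ δ : ℝ, 0 < δ → ∀ᶠ x : ℝ in atTop, ∀ z : ℝ,
      2 ≤ z → z ≤ x ^ θ₀ →
        sigma0 A k x z ≤
          C * x * Real.log x ^ (k - 2) * Real.log z + δ * x * Real.log x ^ (k - 1) := by
  obtain ⟨m, rfl⟩ : ∃ m, k = m + 2 := ⟨k - 2, by omega⟩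
  have e1 : m + 2 - 1 = m + 1 := by omega
  have e2 : m + 2 - 2 = m := by omega
  simp only [e1, e2]
  obtain ⟨K, hK⟩ := hdim
  have hK1 : 1 ≤ K := hK.one_le
  obtain ⟨CV, hCV0, hV⟩ := exists_densityProduct_le A hH
  obtain ⟨C₁, hC₁0, hTd⟩ := exists_sum_density_log_le A hK hlin
  -- the parameters and constants
  set θ₀ : ℝ := 1 / (2 * ((m : ℝ) + 12)) with hθ₀
  have hθ₀0 : 0 < θ₀ := by positivity
  have hθ₀1 : θ₀ ≤ 1 := by
    rw [hθ₀, div_le_one (by positivity)]; linarith [(Nat.cast_nonneg m : (0 : ℝ) ≤ m)]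
  have hhalf : (1 - 1 / 2 : ℝ) = θ₀ * ((m + 12 : ℕ) : ℝ) := by
    rw [hθ₀]; push_cast; field_simp; ring
  set Ck : ℝ := ((m + 2 : ℕ) : ℝ) * 2 ^ (m + 2) + 1 with hCk
  have hCk1 : 1 ≤ Ck := by rw [hCk]; exact le_add_of_nonneg_left (by positivity)
  set Cst : ℝ := (1 + 2 * K ^ 10) * (2 * K) ^ (m + 2) with hCst
  have hCst0 : 0 ≤ Cst := by positivity
  set U : ℝ := 2 ^ (m + 2) * Cst * CV * Ck ^ (m + 2) * C₁ * (max 1 (C₁ * θ₀)) ^ (m + 2) / θ₀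
    with hU
  have hU0 : 0 ≤ U := by positivity
  refine ⟨θ₀, hθ₀0, ((m : ℝ) + 3) * ((m : ℝ) + 3) * U, fun δ hδ => ?_⟩
  -- the level of distribution at level `x^{1/2}` with saving `(log x)^{2k+2}`
  obtain ⟨CR, hCR0, hR⟩ := level_bound A hsize hlevel (one_half_pos (α := ℝ))
    ((2 * (m + 2) + 2 : ℕ) : ℝ)
  have hev3 : ∀ᶠ x : ℝ in atTop,
      ((m : ℝ) + 3) * 2 ^ (m + 2) * Ck ^ (m + 2) * 4 ^ (m + 2) * CR ≤ δ * Real.log x ^ (m + 3) := by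
    have ht : Tendsto (fun x : ℝ => δ * Real.log x ^ (m + 3)) atTop atTop :=
      ((tendsto_pow_atTop (by omega : m + 3 ≠ 0)).comp Real.tendsto_log_atTop).const_mul_atTop hδ
    exact ht.eventually_ge_atTop _
  filter_upwards [hR, hev3, eventually_ge_atTop (3 : ℝ), eventually_ge_atTop (Real.exp 1)]
    with x hRx hevx hx3 hxe z hz hzx
  -- basic facts at this `x`
  have hx0 : 0 < x := by linarith
  have hx1 : 1 < x := by linarith
  set L := Real.log x with hL
  have hL1 : 1 ≤ L := by rw [hL, Real.le_log_iff_exp_le hx0]; exact hxe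
  have hL0 : 0 < L := by linarith
  have hlz0 : 0 ≤ Real.log z := Real.log_nonneg (by linarith)
  -- `ζ = x^{θ₀}`, `D = ζ^{10}`
  set ζ : ℝ := x ^ θ₀ with hζdef
  have hζ2 : 2 ≤ ζ := hz.trans hzx
  have hζ1 : 1 ≤ ζ := by linarith
  have hζ0 : 0 < ζ := by linarith
  have hζx : ζ ≤ x := by
    calc ζ = x ^ θ₀ := rfl
      _ ≤ x ^ (1 : ℝ) := Real.rpow_le_rpow_of_exponent_le hx1.le hθ₀1
      _ = x := Real.rpow_one x
  have hlogζ : Real.log ζ = θ₀ * L := by rw [hζdef, Real.log_rpow hx0]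
  set D : ℝ := ζ ^ 10 with hDdef
  have hD1 : 1 < D := by
    rw [hDdef]; exact one_lt_pow₀ (by linarith) (by norm_num)
  have hζD : 10 * Real.log ζ ≤ Real.log D := by rw [hDdef, Real.log_pow]; push_cast; rfl
  -- the inputs `V₀`, `T_z`, `T_ζ`
  have hV' : A.densityProduct (primesProdBelow ζ) ≤ CV / (θ₀ * L) := by
    rw [← hlogζ]; exact hV ζ hζ2
  have hg0 : ∀ p : ℕ, p.Prime → 0 ≤ A.density p * Real.log p := fun p hp =>
    mul_nonneg (hK.1 p hp).1 (Real.log_nonneg (by exact_mod_cast hp.one_lt.le))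
  have hTz : ∑ p ∈ (Nat.primesBelow ⌈ζ⌉₊).filter (· < ⌈z⌉₊), A.density p * Real.log p ≤
      C₁ * Real.log z := by
    have hsub : (Nat.primesBelow ⌈ζ⌉₊).filter (· < ⌈z⌉₊) ⊆ Nat.primesLE ⌊z⌋₊ := by
      intro p hp
      rw [Finset.mem_filter, Nat.mem_primesBelow] at hp
      exact Nat.mem_primesLE.mpr ⟨Nat.le_floor (Nat.lt_ceil.mp hp.2).le, hp.1.2⟩
    exact (Finset.sum_le_sum_of_subset_of_nonneg hsub fun p hp _ =>
      hg0 p (Nat.mem_primesLE.mp hp).2).trans (hTd z hz)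
  have hTζ : ∑ p ∈ Nat.primesBelow ⌈ζ⌉₊, A.density p * Real.log p ≤ C₁ * (θ₀ * L) := by
    rw [← hlogζ]
    exact (Finset.sum_le_sum_of_subset_of_nonneg (primesBelow_ceil_subset_primesLE_floor ζ)
      fun p hp _ => hg0 p (Nat.mem_primesLE.mp hp).2).trans (hTd ζ hζ2)
  -- the moduli: `ρ d < ζ^{k+10} = x^{1/2}`, squarefree
  set X : ℕ := ⌊x ^ (1 - 1 / 2 : ℝ)⌋₊ with hXdef
  set T : Finset ℕ := (Icc 1 X).filter Squarefree with hTdef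
  have hXT : ∀ n ∈ T, n ≤ X := fun n hn =>
    (Finset.mem_Icc.mp (Finset.mem_filter.mp hn).1).2
  have hpowζ : ζ ^ (m + 2) * ζ ^ 10 = x ^ (1 - 1 / 2 : ℝ) := by
    rw [← pow_add, hhalf, Real.rpow_mul_natCast hx0.le]
  have hPsf : Squarefree (primesProdBelow ζ) := squarefree_primesProdBelow ζ
  have hmod : ∀ ρ ∈ (primesProdBelow ζ).divisors.filter
      (fun ρ : ℕ => ρ.primeFactors.card ≤ m + 2),
      ∀ d ∈ (primesProdBelow ζ / ρ).divisors.filter (fun d : ℕ => (d : ℝ) < D), ρ * d ∈ T := by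
    intro ρ hρ d hd
    rw [Finset.mem_filter] at hρ hd
    have hρP : ρ ∣ primesProdBelow ζ := Nat.dvd_of_mem_divisors hρ.1
    have hρd : ρ * d ∣ primesProdBelow ζ :=
      Nat.mul_dvd_of_dvd_div hρP (Nat.dvd_of_mem_divisors hd.1)
    have hsf : Squarefree (ρ * d) := hPsf.squarefree_of_dvd hρd
    have hρsf : Squarefree ρ := hPsf.squarefree_of_dvd hρP
    have hρle : (ρ : ℝ) ≤ ζ ^ (m + 2) := by
      refine (cast_le_pow_card_primeFactors hρsf fun p hp => ?_).trans
        (pow_le_pow_right₀ hζ1 hρ.2)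
      exact (dvd_primesProdBelow_iff (Nat.prime_of_mem_primeFactors hp) ζ).mp
        ((Nat.dvd_of_mem_primeFactors hp).trans hρP)
    have hlt : ((ρ * d : ℕ) : ℝ) < x ^ (1 - 1 / 2 : ℝ) := by
      rw [← hpowζ, Nat.cast_mul]
      calc (ρ : ℝ) * d ≤ ζ ^ (m + 2) * d := mul_le_mul_of_nonneg_right hρle (Nat.cast_nonneg d)
        _ < ζ ^ (m + 2) * ζ ^ 10 := mul_lt_mul_of_pos_left hd.2 (by positivity)
    refine Finset.mem_filter.mpr ⟨Finset.mem_Icc.mpr ⟨Nat.pos_of_ne_zero hsf.ne_zero, ?_⟩, hsf⟩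
    exact Nat.le_floor hlt.le
  -- the remainders at level `x^{1/2}`
  have hRT : ∑ n ∈ T, |A.remainder n x| ≤ CR * x / L ^ (2 * (m + 2) + 2) := by
    have h := hRx
    rw [Real.rpow_natCast] at h
    exact h
  -- `Σ₀` at this height
  have hS0 := sigma0_bound_at A hK hsize m hx1.le hz hzx hζ2 hζx hD1 hζD hV' hTz hTζ T X hXT hmod hRT
  -- the two sums
  have hmain : ∀ c ∈ Finset.range (m + 3), ∀ w ∈ Finset.range c,
      ((m + 2).choose c : ℝ) * L ^ (m + 2 - c) *
          ((1 + 2 * K ^ 10) * (2 * K) ^ (m + 2) * x * (CV / (θ₀ * L))) *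
        ((((m + 2 : ℕ) : ℝ) * 2 ^ (m + 2) + 1) ^ (w + 1) * L ^ (c - (w + 1)) *
          ((C₁ * Real.log z) * (C₁ * (θ₀ * L)) ^ w)) ≤
      U * x * L ^ m * Real.log z := by
    intro c hc w hw
    have hc' : c ≤ m + 2 := by have := Finset.mem_range.mp hc; omega
    have hw' : w + 1 ≤ c := Finset.mem_range.mp hw
    exact numMain m hc' hw' hCst0 hCV0.le hC₁0.le hCk1 hθ₀0 hL0 hlz0 hx0.le
  have hFib : ((((Nat.log 2 X + 1) ^ (m + 2) : ℕ)) : ℝ) ≤ (4 * L) ^ (m + 2) := by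
    push_cast
    refine pow_le_pow_left₀ (by positivity) ?_ _
    have hXx : (X : ℝ) ≤ 2 * x := by
      calc (X : ℝ) ≤ x ^ (1 - 1 / 2 : ℝ) := Nat.floor_le (by positivity)
        _ ≤ x ^ (1 : ℝ) := Real.rpow_le_rpow_of_exponent_le hx1.le (by norm_num)
        _ = x := Real.rpow_one x
        _ ≤ 2 * x := by linarith
    have h := natLog_two_le hx1.le hXx
    linarith
  have hrem : ∀ c ∈ Finset.range (m + 3),
      ((m + 2).choose c : ℝ) * L ^ (m + 2 - c) *
        ((((m + 2 : ℕ) : ℝ) * 2 ^ (m + 2) + 1) ^ (m + 2) * L ^ c *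
          ((((Nat.log 2 X + 1) ^ (m + 2) : ℕ) : ℝ) * (CR * x / L ^ (2 * (m + 2) + 2)))) ≤
      δ / ((m : ℝ) + 3) * x * L ^ (m + 1) := by
    intro c hc
    have hc' : c ≤ m + 2 := by have := Finset.mem_range.mp hc; omega
    exact numRem m hc' hCk1 hCR0.le hδ hL1 hx0.le (by positivity) hFib hevx
  have ht0 : 0 ≤ U * x * L ^ m * Real.log z := by positivity
  have h1 : ∑ c ∈ Finset.range (m + 3), ∑ w ∈ Finset.range c, U * x * L ^ m * Real.log z ≤
      ((m : ℝ) + 3) * ((m : ℝ) + 3) * U * x * L ^ m * Real.log z := by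
    calc ∑ c ∈ Finset.range (m + 3), ∑ w ∈ Finset.range c, U * x * L ^ m * Real.log z
        ≤ ∑ c ∈ Finset.range (m + 3), ∑ w ∈ Finset.range (m + 3), U * x * L ^ m * Real.log z :=
          Finset.sum_le_sum fun c hc => Finset.sum_le_sum_of_subset_of_nonneg
            (fun w hw => Finset.mem_range.mpr
              ((Finset.mem_range.mp hw).trans (Finset.mem_range.mp hc)))
            fun _ _ _ => ht0
      _ = ((m : ℝ) + 3) * ((m : ℝ) + 3) * U * x * L ^ m * Real.log z := by
          simp only [Finset.sum_const, Finset.card_range, nsmul_eq_mul]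
          push_cast
          ring
  have h2 : ∑ c ∈ Finset.range (m + 3), δ / ((m : ℝ) + 3) * x * L ^ (m + 1) =
      δ * x * L ^ (m + 1) := by
    simp only [Finset.sum_const, Finset.card_range, nsmul_eq_mul]
    have hk3 : (m : ℝ) + 3 ≠ 0 := by positivity
    push_cast
    field_simp
  calc sigma0 A (m + 2) x z ≤ _ := hS0
    _ ≤ (∑ c ∈ Finset.range (m + 3), ∑ w ∈ Finset.range c, U * x * L ^ m * Real.log z) +
          ∑ c ∈ Finset.range (m + 3), δ / ((m : ℝ) + 3) * x * L ^ (m + 1) :=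
        add_le_add (Finset.sum_le_sum fun c hc => Finset.sum_le_sum fun w hw => hmain c hc w hw)
          (Finset.sum_le_sum fun c hc => hrem c hc)
    _ ≤ ((m : ℝ) + 3) * ((m : ℝ) + 3) * U * x * L ^ m * Real.log z + δ * x * L ^ (m + 1) := by
        rw [h2]; exact add_le_add h1 le_rfl

end BombieriSieve

end Literature.NumberTheory.Sieve
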